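import Literature.Analysis.FluidPDE.SingularKernelC3
import Literature.Analysis.FunctionSpaces.HolderAlgebra
import HarnessLib

/-!
# The weakly singular commutator remainder `∫ ∇K(x − y)[g(x) − g(y) − ∇g(y)(x − y)] f(y) dy`

Analysis/FluidPDE support file (everything proved) on the discharge path of Prop. 4.2
(`Literature.Analysis.FluidPDE.MajdaBertozzi2002_lagrangianField_lipschitzOn`). In Eulerian
variables the second part `G₂(X)Y` of the derivative of Majda–Bertozzi's particle-trajectory
operator (Majda–Bertozzi, *Vorticity and Incompressible Flow*, CUP 2002, §4.1.3, p. 130, and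
Lemma 4.10, (4.92)–(4.97), p. 145–147 of the held text) is the commutator integral
`H(x) = ∫ ∇K(x − y)[g(x) − g(y)] f(y) dy` with `g = Y ∘ X⁻¹ ∈ C^{1,γ}` and `f ∈ C^γ_c` the
pushed-forward density. The printed estimate of `|H|_{1,γ}` ("repeat the arguments from the
proof of Lemma 4.6 for a kernel of the type `∇ₓR(x, x')`") is organised here as follows: expand
`g(x) − g(y) = ∇g(y)(x − y) + r(x, y)`; the first part gives convolutions with the stretched
kernels of `SingularKernelC3.lean` (treated downstream by the tree's Hölder theory), and this
file treats the **remainder**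
`Rem(x) = ∫ ∇K(x − y)[r(x, y)] f(y) dy`, `‖r(x, y)‖ ≤ H|x − y|^{1+γ}`,
whose kernel is `O(|x − y|^{γ−2})` with `x`-derivative `O(|x − y|^{γ−3})` — weakly singular, no
principal values:

* `taylorRem`, `remIntegrand`, `remPotential`, `remGradIntegrand`, `remGrad` (the objects) and
  their truncations by the tree's smooth cutoff (`truncKernel (fderiv ℝ K) ε`);
* pointwise bounds, integrability, and the **sup bounds** `‖Rem(x)‖ ≤ A H M c₀(R, γ)`,
  `‖remGrad x‖ ≤ A H M c₁(R, γ)` (uniform in `x`);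
* `hasFDerivAt_remPotential` — **`Rem` is differentiable with `∇Rem = remGrad`** (dominated
  differentiation of the truncations, uniform convergence, Mathlib
  `hasFDerivAt_of_tendstoUniformly`; the pattern of `SingularKernelGradient.lean`);
* `norm_remGrad_sub_le` — **the Hölder estimate** `‖remGrad x − remGrad x̄‖ ≤ H · c · |x − x̄|^γ`
  by the near/far split at the midpoint (near: absolute integrability; far: mean value for
  `∇K`, `∇²K` (third derivatives of `K`), the variation of `r`, and for the one term carrying
  `∇g(x) − ∇g(x̄)` the tree's cancellation lemma `norm_integral_far_ibp_le`).

All constants are linear in the Hölder constant `H` of `∇g`, which downstream is linear in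
`|Y|_{1,γ}`: this is the linear dependence on `Y` in (4.41)/(4.93),
`|G₂(X)Y|_{1,γ} ≤ c(M)‖ω₀‖_γ|Y|_{1,γ}`.

## References

* A. J. Majda, A. L. Bertozzi, *Vorticity and Incompressible Flow* (CUP 2002), §4.1.3
  Prop. 4.2 (p. 128–130), §4.5 Lemma 4.6 and Lemma 4.10 (p. 144–147). [MajdaBertozziCUP2002]
* D. Gilbarg, N. S. Trudinger, *Elliptic PDE of Second Order* (2001), §4.2 (Hölder estimates
  by the midpoint split). [GilbargTrudinger2001]
-/

set_option maxSynthPendingDepth 3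

noncomputable section

open MeasureTheory Set Function Filter Metric Real
open _root_.Topology
open scoped NNReal ENNReal

namespace Literature.Analysis.FluidPDE

/-- Local notation for physical space `ℝ³ = EuclideanSpace ℝ (Fin 3)`. -/
local notation "ℝ³" => EuclideanSpace ℝ (Fin 3)

variable {V W : Type*} [NormedAddCommGroup V] [NormedSpace ℝ V] [NormedAddCommGroup W]
  [NormedSpace ℝ W]

/-! ### A generic integral bound by a majorant -/

/-- **Integral bound by a majorant**: if `‖F y‖ ≤ c ψ(y)` pointwise with `c ≥ 0`, `ψ ≥ 0` and
`∫⁻ ψ ≤ I`, then `‖∫ F‖ ≤ c I`. [folklore] -/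
theorem norm_integral_le_of_le_majorant {E : Type*} [NormedAddCommGroup E] [NormedSpace ℝ E]
    {F : ℝ³ → E} {ψ : ℝ³ → ℝ} {c I : ℝ} (hc : 0 ≤ c) (hI : 0 ≤ I)
    (hψ : ∫⁻ y, ENNReal.ofReal (ψ y) ≤ ENNReal.ofReal I) (h : ∀ y, ‖F y‖ ≤ c * ψ y) :
    ‖∫ y, F y‖ ≤ c * I := by
  have h1 : ‖∫ y, F y‖ₑ ≤ ENNReal.ofReal (c * I) := by
    refine (enorm_integral_le_lintegral_enorm _).trans ?_
    have h2 : ∫⁻ y, ‖F y‖ₑ ≤ ∫⁻ y, ENNReal.ofReal c * ENNReal.ofReal (ψ y) := by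
      refine lintegral_mono fun y => ?_
      rw [← ofReal_norm, ← ENNReal.ofReal_mul hc]
      exact ENNReal.ofReal_le_ofReal (h y)
    refine h2.trans ?_
    rw [lintegral_const_mul' _ _ ENNReal.ofReal_ne_top, ENNReal.ofReal_mul hc]
    gcongr
  rw [← ofReal_norm] at h1
  exact (ENNReal.ofReal_le_ofReal_iff (by positivity)).1 h1

/-- Translated Hölder majorant: `∫⁻ holderMajorant γ ρ (x − y) dy = 4π ρ^γ/γ`. [folklore] -/
theorem lintegral_holderMajorant_sub_left {γ ρ : ℝ} (hγ : 0 < γ) (hρ : 0 ≤ ρ) (x : ℝ³) :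
    ∫⁻ y, ENNReal.ofReal (holderMajorant γ ρ (x - y)) = ENNReal.ofReal (4 * π * ρ ^ γ / γ) := by
  rw [lintegral_sub_left_eq_self (μ := (volume : Measure ℝ³))
    (fun z => ENNReal.ofReal (holderMajorant γ ρ z)) x, lintegral_holderMajorant hγ hρ]

/-- Translated exterior majorant: `∫⁻ extMajorant γ δ (x − y) dy = 4π δ^{γ−1}/(1−γ)`. [folklore] -/
theorem lintegral_extMajorant_sub_left {γ δ : ℝ} (hγ : γ < 1) (hδ : 0 < δ) (x : ℝ³) :
    ∫⁻ y, ENNReal.ofReal (extMajorant γ δ (x - y)) = ENNReal.ofReal (4 * π * δ ^ (γ - 1) / (1 - γ)) := by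
  rw [lintegral_sub_left_eq_self (μ := (volume : Measure ℝ³))
    (fun z => ENNReal.ofReal (extMajorant γ δ z)) x, lintegral_extMajorant hγ hδ]

/-- The indicator majorant: `∫⁻ 1_{B̄(c, r)} = (4/3)π r³` for `r ≥ 0`. [folklore] -/
theorem lintegral_indicator_closedBall {c : ℝ³} {r : ℝ} (hr : 0 ≤ r) :
    ∫⁻ y, ENNReal.ofReal ((closedBall c r).indicator (fun _ => (1 : ℝ)) y) =
      ENNReal.ofReal (4 / 3 * π * r ^ 3) := by
  have h : (fun y => ENNReal.ofReal ((closedBall c r).indicator (fun _ => (1 : ℝ)) y)) =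
      (closedBall c r).indicator (fun _ => (1 : ℝ≥0∞)) := by
    funext y
    by_cases hy : y ∈ closedBall c r <;> simp [hy]
  rw [h, lintegral_indicator measurableSet_closedBall, setLIntegral_const, one_mul,
    EuclideanSpace.volume_closedBall_fin_three, ← ENNReal.ofReal_pow hr, ← ENNReal.ofReal_mul
    (by positivity)]
  congr 1
  ring

/-! ### The Taylor remainder of a `C^{1,γ}` multiplier -/

/-- **The first-order Taylor remainder** `r(x, y) = g(x) − g(y) − ∇g(y)(x − y)` of the
multiplier `g` (in Majda–Bertozzi's `G₂(X)Y`, `g = Y ∘ X⁻¹`, (4.94)). [cite: MajdaBertozziCUP2002, §4.5 Lemma 4.10 (4.94) (p. 146)] -/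
def taylorRem (g : ℝ³ → ℝ³) (x y : ℝ³) : ℝ³ := g x - g y - fderiv ℝ g y (x - y)

/-- `r(x, x) = 0`. [folklore] -/
@[simp]
theorem taylorRem_self (g : ℝ³ → ℝ³) (x : ℝ³) : taylorRem g x x = 0 := by simp [taylorRem]

/-- **Multipliers with `γ`-Hölder gradient**: `g` differentiable with
`‖∇g(x) − ∇g(y)‖ ≤ H ‖x − y‖^γ`. [folklore] -/
structure HolderGrad (γ : ℝ≥0) (g : ℝ³ → ℝ³) (H : ℝ) : Prop where
  /-- `g` is differentiable. -/
  differentiable : Differentiable ℝ g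
  /-- `∇g` is `γ`-Hölder with constant `H`. -/
  norm_sub_le : ∀ x y, ‖fderiv ℝ g x - fderiv ℝ g y‖ ≤ H * ‖x - y‖ ^ (γ : ℝ)

namespace HolderGrad

variable {γ : ℝ≥0} {g : ℝ³ → ℝ³} {H : ℝ}

/-- The constant is nonnegative (test `x ≠ y`). [folklore] -/
theorem nonneg (hg : HolderGrad γ g H) : 0 ≤ H := by
  have h := hg.norm_sub_le (EuclideanSpace.single 0 1) 0
  have hn : ‖(EuclideanSpace.single (0 : Fin 3) (1 : ℝ)) - 0‖ = 1 := by simp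
  rw [hn, Real.one_rpow, mul_one] at h
  exact (norm_nonneg _).trans h

/-- `∇g` is `γ`-Hölder in Mathlib's sense. [folklore] -/
theorem holderWith (hg : HolderGrad γ g H) : HolderWith (Real.toNNReal H) γ (fderiv ℝ g) := by
  refine Literature.Analysis.FunctionSpaces.holderWith_of_dist_le fun x y => ?_
  rw [dist_eq_norm, dist_eq_norm, Real.coe_toNNReal _ hg.nonneg]
  exact hg.norm_sub_le x y

/-- `∇g` is continuous (`γ > 0`). [folklore] -/
theorem continuous_fderiv (hg : HolderGrad γ g H) (hγ : 0 < γ) : Continuous (fderiv ℝ g) :=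
  hg.holderWith.continuous hγ

/-- `g` is continuous. [folklore] -/
theorem continuous (hg : HolderGrad γ g H) : Continuous g := hg.differentiable.continuous

/-- **Size of the Taylor remainder**: `‖r(x, y)‖ ≤ H ‖x − y‖^{1+γ}` (mean value inequality
for `t ↦ g(y + t(x − y)) − t ∇g(y)(x − y)`). [folklore] -/
theorem norm_taylorRem_le (hg : HolderGrad γ g H) (x y : ℝ³) :
    ‖taylorRem g x y‖ ≤ H * ‖x - y‖ ^ (1 + (γ : ℝ)) := by
  have hH := hg.nonneg
  set v : ℝ³ := x - y with hv
  set φ : ℝ → ℝ³ := fun t => g (y + t • v) - t • fderiv ℝ g y v with hφ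
  have hφd : ∀ t : ℝ, HasDerivAt φ (fderiv ℝ g (y + t • v) v - fderiv ℝ g y v) t := by
    intro t
    have h1 : HasDerivAt (fun t : ℝ => y + t • v) v t := by
      simpa using ((hasDerivAt_id t).smul_const v).const_add y
    have h2 : HasDerivAt (g ∘ fun t : ℝ => y + t • v) (fderiv ℝ g (y + t • v) v) t :=
      (hg.differentiable (y + t • v)).hasFDerivAt.comp_hasDerivAt t h1
    have h3 : HasDerivAt (fun t : ℝ => t • fderiv ℝ g y v) (fderiv ℝ g y v) t := by
      simpa using (hasDerivAt_id t).smul_const (fderiv ℝ g y v)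
    exact h2.sub h3
  have hbound : ∀ t ∈ Ico (0 : ℝ) 1, ‖fderiv ℝ g (y + t • v) v - fderiv ℝ g y v‖ ≤
      H * ‖v‖ ^ (1 + (γ : ℝ)) := by
    intro t ht
    change ‖(fderiv ℝ g (y + t • v) - fderiv ℝ g y) v‖ ≤ _
    refine (ContinuousLinearMap.le_opNorm _ _).trans ?_
    have hdiff := hg.norm_sub_le (y + t • v) y
    rw [show y + t • v - y = t • v by abel, norm_smul, Real.norm_eq_abs, abs_of_nonneg ht.1] at hdiff
    have ht1 : (t * ‖v‖) ^ (γ : ℝ) ≤ ‖v‖ ^ (γ : ℝ) := by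
      refine Real.rpow_le_rpow (mul_nonneg ht.1 (norm_nonneg v)) ?_ (by positivity)
      nlinarith [norm_nonneg v, ht.2, ht.1]
    calc ‖fderiv ℝ g (y + t • v) - fderiv ℝ g y‖ * ‖v‖ ≤ H * (t * ‖v‖) ^ (γ : ℝ) * ‖v‖ := by gcongr
      _ ≤ H * ‖v‖ ^ (γ : ℝ) * ‖v‖ := by gcongr
      _ = H * ‖v‖ ^ (1 + (γ : ℝ)) := by
          rw [Real.rpow_add' (norm_nonneg v) (by positivity), Real.rpow_one]; ring
  have key := norm_image_sub_le_of_norm_deriv_le_segment_01' (fun t _ => (hφd t).hasDerivWithinAt) hbound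
  have hφ1 : φ 1 = g x - fderiv ℝ g y v := by simp only [hφ, one_smul, hv, add_sub_cancel]
  have hφ0 : φ 0 = g y := by simp [hφ]
  rw [hφ1, hφ0] at key
  calc ‖taylorRem g x y‖ = ‖g x - fderiv ℝ g y v - g y‖ := by rw [taylorRem, hv]; congr 1; abel
    _ ≤ H * ‖v‖ ^ (1 + (γ : ℝ)) := key

/-- **Variation of the Taylor remainder in `x`**: `r(x, y) − r(x̄, y) = g x − g x̄ − ∇g(y)(x − x̄)`,
of norm `≤ H ‖x − x̄‖ (‖ξ − y‖ + ‖x − x̄‖/2)^γ`, `ξ` the midpoint (mean value along `[x̄, x]`,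
whose points are within `‖x − x̄‖/2` of `ξ`). [folklore] -/
theorem norm_taylorRem_sub_le (hg : HolderGrad γ g H) (x x' y : ℝ³) :
    ‖taylorRem g x y - taylorRem g x' y‖ ≤
      H * ‖x - x'‖ * (‖mid x x' - y‖ + ‖x - x'‖ / 2) ^ (γ : ℝ) := by
  have hH := hg.nonneg
  set v : ℝ³ := x - x' with hv
  set φ : ℝ → ℝ³ := fun t => g (x' + t • v) - t • fderiv ℝ g y v with hφ
  have hφd : ∀ t : ℝ, HasDerivAt φ (fderiv ℝ g (x' + t • v) v - fderiv ℝ g y v) t := by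
    intro t
    have h1 : HasDerivAt (fun t : ℝ => x' + t • v) v t := by
      simpa using ((hasDerivAt_id t).smul_const v).const_add x'
    have h2 : HasDerivAt (g ∘ fun t : ℝ => x' + t • v) (fderiv ℝ g (x' + t • v) v) t :=
      (hg.differentiable (x' + t • v)).hasFDerivAt.comp_hasDerivAt t h1
    have h3 : HasDerivAt (fun t : ℝ => t • fderiv ℝ g y v) (fderiv ℝ g y v) t := by
      simpa using (hasDerivAt_id t).smul_const (fderiv ℝ g y v)
    exact h2.sub h3
  have hbound : ∀ t ∈ Ico (0 : ℝ) 1, ‖fderiv ℝ g (x' + t • v) v - fderiv ℝ g y v‖ ≤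
      H * ‖v‖ * (‖mid x x' - y‖ + ‖v‖ / 2) ^ (γ : ℝ) := by
    intro t ht
    change ‖(fderiv ℝ g (x' + t • v) - fderiv ℝ g y) v‖ ≤ _
    refine (ContinuousLinearMap.le_opNorm _ _).trans ?_
    have hdiff := hg.norm_sub_le (x' + t • v) y
    -- the point `x' + t v` is within `‖v‖/2` of the midpoint
    have hdist : ‖x' + t • v - y‖ ≤ ‖mid x x' - y‖ + ‖v‖ / 2 := by
      have h1 : x' + t • v - y = (mid x x' - y) + (t - 2⁻¹) • v := by
        simp only [mid, hv, smul_sub, sub_smul, smul_add]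
        module
      rw [h1]
      refine (norm_add_le _ _).trans ?_
      gcongr
      rw [norm_smul, Real.norm_eq_abs]
      have ht2 : |t - 2⁻¹| ≤ 1 / 2 := by
        rw [abs_le]; constructor <;> linarith [ht.1, ht.2]
      calc |t - 2⁻¹| * ‖v‖ ≤ 1 / 2 * ‖v‖ := by gcongr
        _ = ‖v‖ / 2 := by ring
    calc ‖fderiv ℝ g (x' + t • v) - fderiv ℝ g y‖ * ‖v‖ ≤ H * ‖x' + t • v - y‖ ^ (γ : ℝ) * ‖v‖ := by
          gcongr
      _ ≤ H * (‖mid x x' - y‖ + ‖v‖ / 2) ^ (γ : ℝ) * ‖v‖ := by gcongr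
      _ = H * ‖v‖ * (‖mid x x' - y‖ + ‖v‖ / 2) ^ (γ : ℝ) := by ring
  have key := norm_image_sub_le_of_norm_deriv_le_segment_01' (fun t _ => (hφd t).hasDerivWithinAt) hbound
  have hφ1 : φ 1 = g x - fderiv ℝ g y v := by simp only [hφ, one_smul, hv, add_sub_cancel]
  have hφ0 : φ 0 = g x' := by simp [hφ]
  rw [hφ1, hφ0] at key
  have hid : taylorRem g x y - taylorRem g x' y = g x - fderiv ℝ g y v - g x' := by
    simp only [taylorRem, hv, map_sub]
    abel
  rw [hid]
  exact key

/-- The Taylor remainder is continuous in `y`. [folklore] -/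
theorem continuous_taylorRem (hg : HolderGrad γ g H) (hγ : 0 < γ) (x : ℝ³) :
    Continuous (taylorRem g x) := by
  unfold taylorRem
  exact (continuous_const.sub hg.continuous).sub
    ((hg.continuous_fderiv hγ).clm_apply (continuous_const.sub continuous_id))

/-- The Taylor remainder is jointly continuous. [folklore] -/
theorem continuous_taylorRem₂ (hg : HolderGrad γ g H) (hγ : 0 < γ) :
    Continuous (fun p : ℝ³ × ℝ³ => taylorRem g p.1 p.2) := by
  unfold taylorRem
  exact ((hg.continuous.comp continuous_fst).sub (hg.continuous.comp continuous_snd)).sub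
    (((hg.continuous_fderiv hγ).comp continuous_snd).clm_apply (continuous_fst.sub continuous_snd))

/-- **Differentiability in `x`**: `∇ₓ r(x, y) = ∇g(x) − ∇g(y)`. [folklore] -/
theorem hasFDerivAt_taylorRem (hg : HolderGrad γ g H) (x y : ℝ³) :
    HasFDerivAt (fun x => taylorRem g x y) (fderiv ℝ g x - fderiv ℝ g y) x := by
  unfold taylorRem
  have h1 : HasFDerivAt g (fderiv ℝ g x) x := (hg.differentiable x).hasFDerivAt
  have h2 : HasFDerivAt (fun x : ℝ³ => fderiv ℝ g y (x - y)) (fderiv ℝ g y) x := by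
    have := (fderiv ℝ g y).hasFDerivAt.comp x ((hasFDerivAt_id x).sub_const y)
    rw [ContinuousLinearMap.comp_id] at this
    exact this
  have h := (h1.sub_const (g y)).sub h2
  exact h

end HolderGrad

/-! ### The truncated derivative kernel `P_ε = (1 − θ_ε) ∇K` -/

section DerivKernel

variable {K : ℝ³ → V →L[ℝ] W} {A : ℝ}

/-- `P_ε(z) = 0` for `‖z‖ ≤ ε`, in particular at the origin. [folklore] -/
theorem truncKernel_fderiv_eq_zero (K : ℝ³ → V →L[ℝ] W) {ε : ℝ} (hε : 0 < ε) {z : ℝ³}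
    (hz : ‖z‖ ≤ ε) : truncKernel (fderiv ℝ K) ε z = 0 :=
  truncKernel_eq_zero _ hε hz

/-- **Size**: `‖P_ε(z)‖ ≤ A |z|⁻³` (the value at the origin is `0`). [folklore] -/
theorem norm_truncKernel_fderiv_le (hK : IsC1SingularKernel K A) {ε : ℝ} (hε : 0 < ε) (z : ℝ³) :
    ‖truncKernel (fderiv ℝ K) ε z‖ ≤ A * (‖z‖ ^ 3)⁻¹ := by
  rcases eq_or_ne z 0 with rfl | hz
  · rw [truncKernel_fderiv_eq_zero K hε (by rw [norm_zero]; exact hε.le), norm_zero]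
    exact mul_nonneg hK.nonneg (by positivity)
  · rw [truncKernel, norm_smul, Real.norm_eq_abs]
    have h1 : |1 - radialCutoff ε (2 * ε) z| ≤ 1 := by
      rw [abs_le]
      constructor <;> linarith [radialCutoff_nonneg ε (2 * ε) z, radialCutoff_le_one ε (2 * ε) z]
    calc |1 - radialCutoff ε (2 * ε) z| * ‖fderiv ℝ K z‖ ≤ 1 * ‖fderiv ℝ K z‖ := by gcongr
      _ ≤ A * (‖z‖ ^ 3)⁻¹ := by rw [one_mul]; exact hK.norm_fderiv_le z hz

/-- **Uniform size**: `‖P_ε(z)‖ ≤ A ε⁻³`. [folklore] -/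
theorem norm_truncKernel_fderiv_le_const (hK : IsC1SingularKernel K A) {ε : ℝ} (hε : 0 < ε) (z : ℝ³) :
    ‖truncKernel (fderiv ℝ K) ε z‖ ≤ A * (ε ^ 3)⁻¹ := by
  rcases le_or_gt ‖z‖ ε with hz | hz
  · rw [truncKernel_fderiv_eq_zero K hε hz, norm_zero]
    exact mul_nonneg hK.nonneg (by positivity)
  · refine (norm_truncKernel_fderiv_le hK hε z).trans ?_
    have := hK.nonneg
    gcongr

/-- **`P_ε` is `C¹` on all of `ℝ³`** (zero near the origin; off it the product of the smooth
`1 − θ_ε` with the `C²` map `∇K`). [folklore] -/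
theorem contDiff_truncKernel_fderiv (hK : IsC3SingularKernel K A) {ε : ℝ} (hε : 0 < ε) :
    ContDiff ℝ 1 (truncKernel (fderiv ℝ K) ε) := by
  rw [contDiff_iff_contDiffAt]
  intro z
  by_cases hz : ‖z‖ < ε
  · exact (contDiffAt_const (c := (0 : ℝ³ →L[ℝ] V →L[ℝ] W))).congr_of_eventuallyEq
      (truncKernel_eventuallyEq_zero _ hε hz)
  · have hz0 : z ≠ 0 := by
      intro h
      rw [h, norm_zero] at hz
      exact hz hε
    have hθc : ContDiff ℝ 1 (radialCutoff ε (2 * ε) : ℝ³ → ℝ) := radialCutoff_contDiff ε (2 * ε)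
    exact (contDiff_const.sub hθc).contDiffAt.smul ((hK.contDiffAt_fderiv hz0).of_le one_le_two)

/-- The derivative of `P_ε` off the origin (product rule):
`∇P_ε(z) e = −(∇θ_ε(z) e) ∇K(z) + (1 − θ_ε(z)) ∇²K(z) e`. [folklore] -/
theorem fderiv_truncKernel_fderiv_apply (hK : IsC3SingularKernel K A) {ε : ℝ} {z : ℝ³} (hz : z ≠ 0)
    (e : ℝ³) :
    fderiv ℝ (truncKernel (fderiv ℝ K) ε) z e =
      -(fderiv ℝ (radialCutoff ε (2 * ε)) z e) • fderiv ℝ K z +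
        (1 - radialCutoff ε (2 * ε) z) • fderiv ℝ (fderiv ℝ K) z e := by
  have hθ : DifferentiableAt ℝ (fun w : ℝ³ => 1 - radialCutoff ε (2 * ε) w) z :=
    ((radialCutoff_contDiff (E' := ℝ³) ε (2 * ε) (n := 1)).differentiable one_ne_zero z).const_sub 1
  change fderiv ℝ (fun w => (1 - radialCutoff ε (2 * ε) w) • fderiv ℝ K w) z e = _
  rw [fderiv_fun_smul hθ (hK.differentiableAt_fderiv hz), fderiv_const_sub]
  simp only [add_apply, smul_apply, ContinuousLinearMap.smulRight_apply, neg_apply, neg_smul]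
  abel

/-- **Size of `∇P_ε`**: `‖∇P_ε(z)‖ ≤ A(1 + 2B) |z|⁻⁴` for `z ≠ 0`, `B` the cutoff constant. [folklore] -/
theorem norm_fderiv_truncKernel_fderiv_le (hK : IsC3SingularKernel K A) {B : ℝ} (hB0 : 0 ≤ B)
    (hB : ∀ ε : ℝ, 0 < ε → ∀ z : ℝ³, ‖fderiv ℝ (radialCutoff ε (2 * ε)) z‖ ≤ B * ε⁻¹)
    {ε : ℝ} (hε : 0 < ε) {z : ℝ³} (hz : z ≠ 0) :
    ‖fderiv ℝ (truncKernel (fderiv ℝ K) ε) z‖ ≤ A * (1 + 2 * B) * (‖z‖ ^ 4)⁻¹ := by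
  have hA := hK.nonneg
  have hzn : 0 < ‖z‖ := norm_pos_iff.2 hz
  by_cases hsmall : ‖z‖ < ε
  · have h0 : fderiv ℝ (truncKernel (fderiv ℝ K) ε) z = 0 := by
      rw [(truncKernel_eventuallyEq_zero _ hε hsmall).fderiv_eq]
      exact fderiv_const_apply 0
    rw [h0, norm_zero]
    positivity
  · refine ContinuousLinearMap.opNorm_le_bound _ (by positivity) fun e => ?_
    rw [fderiv_truncKernel_fderiv_apply hK hz e]
    have hcut : ‖-(fderiv ℝ (radialCutoff ε (2 * ε)) z e) • fderiv ℝ K z‖ ≤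
        2 * A * B * (‖z‖ ^ 4)⁻¹ * ‖e‖ := by
      by_cases hbig : 2 * ε < ‖z‖
      · have h0 : fderiv ℝ (radialCutoff ε (2 * ε)) z = 0 := by
          rw [(radialCutoff_eventuallyEq_zero (E := ℝ³) hε.le (by linarith) hbig).fderiv_eq]
          exact fderiv_const_apply (0 : ℝ)
        rw [h0, zero_apply, neg_zero, zero_smul, norm_zero]
        positivity
      · have hz2 : ‖z‖ ≤ 2 * ε := not_lt.1 hbig
        rw [norm_smul, norm_neg, Real.norm_eq_abs]
        have h1 : |fderiv ℝ (radialCutoff ε (2 * ε)) z e| ≤ B * ε⁻¹ * ‖e‖ := by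
          rw [← Real.norm_eq_abs]
          exact (ContinuousLinearMap.le_opNorm _ e).trans (by gcongr; exact hB ε hε z)
        have h2 : ‖fderiv ℝ K z‖ ≤ A * (‖z‖ ^ 3)⁻¹ := hK.norm_fderiv_le z hz
        have hεinv : ε⁻¹ ≤ 2 * ‖z‖⁻¹ := by
          rw [← div_eq_mul_inv, le_div_iff₀ hzn, inv_mul_le_iff₀ hε]
          linarith
        calc |fderiv ℝ (radialCutoff ε (2 * ε)) z e| * ‖fderiv ℝ K z‖
            ≤ (B * ε⁻¹ * ‖e‖) * (A * (‖z‖ ^ 3)⁻¹) := by gcongr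
          _ ≤ (B * (2 * ‖z‖⁻¹) * ‖e‖) * (A * (‖z‖ ^ 3)⁻¹) := by gcongr
          _ = 2 * A * B * (‖z‖ ^ 4)⁻¹ * ‖e‖ := by field_simp
    have hker : ‖(1 - radialCutoff ε (2 * ε) z) • fderiv ℝ (fderiv ℝ K) z e‖ ≤
        A * (‖z‖ ^ 4)⁻¹ * ‖e‖ := by
      rw [norm_smul, Real.norm_eq_abs]
      have h1 : |1 - radialCutoff ε (2 * ε) z| ≤ 1 := by
        rw [abs_le]
        constructor <;>
          linarith [radialCutoff_nonneg ε (2 * ε) z, radialCutoff_le_one ε (2 * ε) z]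
      have h2 : ‖fderiv ℝ (fderiv ℝ K) z e‖ ≤ A * (‖z‖ ^ 4)⁻¹ * ‖e‖ :=
        (ContinuousLinearMap.le_opNorm _ e).trans (by gcongr; exact hK.norm_fderiv₂_le z hz)
      calc |1 - radialCutoff ε (2 * ε) z| * ‖fderiv ℝ (fderiv ℝ K) z e‖
          ≤ 1 * (A * (‖z‖ ^ 4)⁻¹ * ‖e‖) := by gcongr
        _ = A * (‖z‖ ^ 4)⁻¹ * ‖e‖ := one_mul _
    calc ‖-(fderiv ℝ (radialCutoff ε (2 * ε)) z e) • fderiv ℝ K z +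
            (1 - radialCutoff ε (2 * ε) z) • fderiv ℝ (fderiv ℝ K) z e‖
        ≤ ‖-(fderiv ℝ (radialCutoff ε (2 * ε)) z e) • fderiv ℝ K z‖ +
            ‖(1 - radialCutoff ε (2 * ε) z) • fderiv ℝ (fderiv ℝ K) z e‖ := norm_add_le _ _
      _ ≤ 2 * A * B * (‖z‖ ^ 4)⁻¹ * ‖e‖ + A * (‖z‖ ^ 4)⁻¹ * ‖e‖ := add_le_add hcut hker
      _ = A * (1 + 2 * B) * (‖z‖ ^ 4)⁻¹ * ‖e‖ := by ring

/-- **Uniform size of `∇P_ε`**: `‖∇P_ε(z)‖ ≤ A(1 + 2B) ε⁻⁴` for all `z`. [folklore] -/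
theorem norm_fderiv_truncKernel_fderiv_le_const (hK : IsC3SingularKernel K A) {B : ℝ} (hB0 : 0 ≤ B)
    (hB : ∀ ε : ℝ, 0 < ε → ∀ z : ℝ³, ‖fderiv ℝ (radialCutoff ε (2 * ε)) z‖ ≤ B * ε⁻¹)
    {ε : ℝ} (hε : 0 < ε) (z : ℝ³) :
    ‖fderiv ℝ (truncKernel (fderiv ℝ K) ε) z‖ ≤ A * (1 + 2 * B) * (ε ^ 4)⁻¹ := by
  have hA := hK.nonneg
  by_cases hsmall : ‖z‖ < ε
  · have h0 : fderiv ℝ (truncKernel (fderiv ℝ K) ε) z = 0 := by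
      rw [(truncKernel_eventuallyEq_zero _ hε hsmall).fderiv_eq]
      exact fderiv_const_apply 0
    rw [h0, norm_zero]
    positivity
  · have hεz : ε ≤ ‖z‖ := not_lt.1 hsmall
    have hz : z ≠ 0 := by
      intro h
      rw [h, norm_zero] at hεz
      exact absurd hεz (not_le.2 hε)
    refine (norm_fderiv_truncKernel_fderiv_le hK hB0 hB hε hz).trans ?_
    gcongr

end DerivKernel

/-! ### The remainder integrands and potentials -/

/-- **The remainder integrand** `∇K(x − y)[r(x, y)] f(y)`. [cite: MajdaBertozziCUP2002, §4.5 Lemma 4.10 (4.94) (p. 146)] -/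
def remIntegrand (K : ℝ³ → V →L[ℝ] W) (g : ℝ³ → ℝ³) (f : ℝ³ → V) (x y : ℝ³) : W :=
  fderiv ℝ K (x - y) (taylorRem g x y) (f y)

/-- **The remainder** `Rem(x) = ∫ ∇K(x − y)[r(x, y)] f(y) dy`. [cite: MajdaBertozziCUP2002, §4.5 Lemma 4.10 (4.94) (p. 146)] -/
def remPotential (K : ℝ³ → V →L[ℝ] W) (g : ℝ³ → ℝ³) (f : ℝ³ → V) (x : ℝ³) : W :=
  ∫ y, remIntegrand K g f x y

/-- **The derivative integrand** `e ↦ ∇²K(x − y)[e][r(x, y)] f(y) + ∇K(x − y)[(∇g(x) − ∇g(y)) e] f(y)`. [folklore] -/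
def remGradIntegrand (K : ℝ³ → V →L[ℝ] W) (g : ℝ³ → ℝ³) (f : ℝ³ → V) (x y : ℝ³) : ℝ³ →L[ℝ] W :=
  ((fderiv ℝ (fderiv ℝ K) (x - y)).flip (taylorRem g x y)).flip (f y) +
    ((fderiv ℝ K (x - y)).flip (f y)).comp (fderiv ℝ g x - fderiv ℝ g y)

/-- **The derivative of the remainder** `remGrad x = ∫ remGradIntegrand x y dy`. [folklore] -/
def remGrad (K : ℝ³ → V →L[ℝ] W) (g : ℝ³ → ℝ³) (f : ℝ³ → V) (x : ℝ³) : ℝ³ →L[ℝ] W :=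
  ∫ y, remGradIntegrand K g f x y

/-- The truncated remainder integrand (`∇K` replaced by `P_ε`). [folklore] -/
def remIntegrandT (K : ℝ³ → V →L[ℝ] W) (g : ℝ³ → ℝ³) (f : ℝ³ → V) (ε : ℝ) (x y : ℝ³) : W :=
  truncKernel (fderiv ℝ K) ε (x - y) (taylorRem g x y) (f y)

/-- The truncated remainder. [folklore] -/
def remPotentialT (K : ℝ³ → V →L[ℝ] W) (g : ℝ³ → ℝ³) (f : ℝ³ → V) (ε : ℝ) (x : ℝ³) : W :=
  ∫ y, remIntegrandT K g f ε x y

/-- The truncated derivative integrand. [folklore] -/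
def remGradIntegrandT (K : ℝ³ → V →L[ℝ] W) (g : ℝ³ → ℝ³) (f : ℝ³ → V) (ε : ℝ) (x y : ℝ³) :
    ℝ³ →L[ℝ] W :=
  ((fderiv ℝ (truncKernel (fderiv ℝ K) ε) (x - y)).flip (taylorRem g x y)).flip (f y) +
    ((truncKernel (fderiv ℝ K) ε (x - y)).flip (f y)).comp (fderiv ℝ g x - fderiv ℝ g y)

/-- The truncated derivative. [folklore] -/
def remGradT (K : ℝ³ → V →L[ℝ] W) (g : ℝ³ → ℝ³) (f : ℝ³ → V) (ε : ℝ) (x : ℝ³) : ℝ³ →L[ℝ] W :=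
  ∫ y, remGradIntegrandT K g f ε x y

/-! ### Elementary norm bounds for the flipped evaluations -/

section FlipBounds

/-- `‖((D.flip ρ).flip v)‖ ≤ ‖D‖ ‖ρ‖ ‖v‖` for `D : ℝ³ →L ℝ³ →L V →L W`. [folklore] -/
theorem norm_flip_flip_le (D : ℝ³ →L[ℝ] ℝ³ →L[ℝ] V →L[ℝ] W) (ρ : ℝ³) (v : V) :
    ‖(D.flip ρ).flip v‖ ≤ ‖D‖ * ‖ρ‖ * ‖v‖ := by
  calc ‖(D.flip ρ).flip v‖ ≤ ‖(D.flip ρ).flip‖ * ‖v‖ := ContinuousLinearMap.le_opNorm _ _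
    _ = ‖D.flip ρ‖ * ‖v‖ := by rw [ContinuousLinearMap.opNorm_flip]
    _ ≤ ‖D.flip‖ * ‖ρ‖ * ‖v‖ := by gcongr; exact ContinuousLinearMap.le_opNorm _ _
    _ = ‖D‖ * ‖ρ‖ * ‖v‖ := by rw [ContinuousLinearMap.opNorm_flip]

/-- `‖(P.flip v).comp L‖ ≤ ‖P‖ ‖v‖ ‖L‖` for `P : ℝ³ →L V →L W`. [folklore] -/
theorem norm_flip_comp_le (P : ℝ³ →L[ℝ] V →L[ℝ] W) (v : V) (L : ℝ³ →L[ℝ] ℝ³) :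
    ‖(P.flip v).comp L‖ ≤ ‖P‖ * ‖v‖ * ‖L‖ := by
  calc ‖(P.flip v).comp L‖ ≤ ‖P.flip v‖ * ‖L‖ := ContinuousLinearMap.opNorm_comp_le _ _
    _ ≤ ‖P.flip‖ * ‖v‖ * ‖L‖ := by gcongr; exact ContinuousLinearMap.le_opNorm _ _
    _ = ‖P‖ * ‖v‖ * ‖L‖ := by rw [ContinuousLinearMap.opNorm_flip]

end FlipBounds

/-! ### Pointwise bounds -/

section Pointwise

variable {K : ℝ³ → V →L[ℝ] W} {A : ℝ} {γ : ℝ≥0} {g : ℝ³ → ℝ³} {H : ℝ} {f : ℝ³ → V}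

/-- `t^{1+γ} (t³)⁻¹ = t^{γ−2}` for `t > 0`. [folklore] -/
theorem rpow_one_add_mul_inv_pow_three {t : ℝ} (ht : 0 < t) (γ : ℝ) :
    t ^ (1 + γ) * (t ^ 3)⁻¹ = t ^ (γ - 2) := by
  rw [show γ - 2 = (1 + γ) - ((3 : ℕ) : ℝ) by push_cast; ring, Real.rpow_sub ht, Real.rpow_natCast,
    div_eq_mul_inv]

/-- `t^{1+γ} (t⁴)⁻¹ = t^{γ−3}` for `t > 0`. [folklore] -/
theorem rpow_one_add_mul_inv_pow_four {t : ℝ} (ht : 0 < t) (γ : ℝ) :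
    t ^ (1 + γ) * (t ^ 4)⁻¹ = t ^ (γ - 3) := by
  rw [show γ - 3 = (1 + γ) - ((4 : ℕ) : ℝ) by push_cast; ring, Real.rpow_sub ht, Real.rpow_natCast,
    div_eq_mul_inv]

/-- **Pointwise bound of the remainder integrand**: `‖∇K(x−y)[r(x,y)] f(y)‖ ≤ A H ‖f y‖ |x−y|^{γ−2}`
(for `x = y` both sides vanish). [folklore] -/
theorem norm_remIntegrand_le (hK : IsC1SingularKernel K A) (hg : HolderGrad γ g H) (x y : ℝ³) :
    ‖remIntegrand K g f x y‖ ≤ A * H * ‖f y‖ * ‖x - y‖ ^ ((γ : ℝ) - 2) := by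
  have hA := hK.nonneg
  have hH := hg.nonneg
  rcases eq_or_ne x y with rfl | hxy
  · simp only [remIntegrand, taylorRem_self, map_zero, zero_apply, norm_zero]
    positivity
  · have hpos : 0 < ‖x - y‖ := norm_pos_iff.2 (sub_ne_zero.2 hxy)
    unfold remIntegrand
    calc ‖fderiv ℝ K (x - y) (taylorRem g x y) (f y)‖
        ≤ ‖fderiv ℝ K (x - y) (taylorRem g x y)‖ * ‖f y‖ := ContinuousLinearMap.le_opNorm _ _
      _ ≤ ‖fderiv ℝ K (x - y)‖ * ‖taylorRem g x y‖ * ‖f y‖ := by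
          gcongr; exact ContinuousLinearMap.le_opNorm _ _
      _ ≤ A * (‖x - y‖ ^ 3)⁻¹ * (H * ‖x - y‖ ^ (1 + (γ : ℝ))) * ‖f y‖ := by
          gcongr
          · exact hK.norm_fderiv_le _ (sub_ne_zero.2 hxy)
          · exact hg.norm_taylorRem_le x y
      _ = A * H * ‖f y‖ * (‖x - y‖ ^ (1 + (γ : ℝ)) * (‖x - y‖ ^ 3)⁻¹) := by ring
      _ = A * H * ‖f y‖ * ‖x - y‖ ^ ((γ : ℝ) - 2) := by
          rw [rpow_one_add_mul_inv_pow_three hpos]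

/-- The same bound for the truncated integrand. [folklore] -/
theorem norm_remIntegrandT_le (hK : IsC1SingularKernel K A) (hg : HolderGrad γ g H) {ε : ℝ}
    (hε : 0 < ε) (x y : ℝ³) :
    ‖remIntegrandT K g f ε x y‖ ≤ A * H * ‖f y‖ * ‖x - y‖ ^ ((γ : ℝ) - 2) := by
  have hA := hK.nonneg
  have hH := hg.nonneg
  rcases eq_or_ne x y with rfl | hxy
  · simp only [remIntegrandT, taylorRem_self, map_zero, zero_apply, norm_zero]
    positivity
  · have hpos : 0 < ‖x - y‖ := norm_pos_iff.2 (sub_ne_zero.2 hxy)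
    unfold remIntegrandT
    calc ‖truncKernel (fderiv ℝ K) ε (x - y) (taylorRem g x y) (f y)‖
        ≤ ‖truncKernel (fderiv ℝ K) ε (x - y) (taylorRem g x y)‖ * ‖f y‖ :=
          ContinuousLinearMap.le_opNorm _ _
      _ ≤ ‖truncKernel (fderiv ℝ K) ε (x - y)‖ * ‖taylorRem g x y‖ * ‖f y‖ := by
          gcongr; exact ContinuousLinearMap.le_opNorm _ _
      _ ≤ A * (‖x - y‖ ^ 3)⁻¹ * (H * ‖x - y‖ ^ (1 + (γ : ℝ))) * ‖f y‖ := by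
          gcongr
          · exact norm_truncKernel_fderiv_le hK hε _
          · exact hg.norm_taylorRem_le x y
      _ = A * H * ‖f y‖ * (‖x - y‖ ^ (1 + (γ : ℝ)) * (‖x - y‖ ^ 3)⁻¹) := by ring
      _ = A * H * ‖f y‖ * ‖x - y‖ ^ ((γ : ℝ) - 2) := by
          rw [rpow_one_add_mul_inv_pow_three hpos]

/-- **Pointwise bound of the derivative integrand**:
`‖remGradIntegrand x y‖ ≤ 2 A H ‖f y‖ |x − y|^{γ−3}`. [folklore] -/
theorem norm_remGradIntegrand_le (hK : IsC3SingularKernel K A) (hg : HolderGrad γ g H) (x y : ℝ³) :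
    ‖remGradIntegrand K g f x y‖ ≤ 2 * A * H * ‖f y‖ * ‖x - y‖ ^ ((γ : ℝ) - 3) := by
  have hA := hK.nonneg
  have hH := hg.nonneg
  rcases eq_or_ne x y with rfl | hxy
  · unfold remGradIntegrand
    simp only [sub_self, taylorRem_self]
    have h1 := norm_flip_flip_le (fderiv ℝ (fderiv ℝ K) 0) (0 : ℝ³) (f x)
    have h2 := norm_flip_comp_le (fderiv ℝ K 0) (f x) (0 : ℝ³ →L[ℝ] ℝ³)
    rw [norm_zero, mul_zero, zero_mul] at h1
    rw [norm_zero, mul_zero] at h2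
    refine ((norm_add_le _ _).trans (add_le_add h1 h2)).trans ?_
    rw [add_zero]
    positivity
  · have hne : x - y ≠ 0 := sub_ne_zero.2 hxy
    have hpos : 0 < ‖x - y‖ := norm_pos_iff.2 hne
    unfold remGradIntegrand
    have h1 : ‖((fderiv ℝ (fderiv ℝ K) (x - y)).flip (taylorRem g x y)).flip (f y)‖ ≤
        A * H * ‖f y‖ * ‖x - y‖ ^ ((γ : ℝ) - 3) := by
      refine (norm_flip_flip_le _ _ _).trans ?_
      calc ‖fderiv ℝ (fderiv ℝ K) (x - y)‖ * ‖taylorRem g x y‖ * ‖f y‖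
          ≤ A * (‖x - y‖ ^ 4)⁻¹ * (H * ‖x - y‖ ^ (1 + (γ : ℝ))) * ‖f y‖ := by
            gcongr
            · exact hK.norm_fderiv₂_le _ hne
            · exact hg.norm_taylorRem_le x y
        _ = A * H * ‖f y‖ * (‖x - y‖ ^ (1 + (γ : ℝ)) * (‖x - y‖ ^ 4)⁻¹) := by ring
        _ = A * H * ‖f y‖ * ‖x - y‖ ^ ((γ : ℝ) - 3) := by
            rw [rpow_one_add_mul_inv_pow_four hpos]
    have h2 : ‖((fderiv ℝ K (x - y)).flip (f y)).comp (fderiv ℝ g x - fderiv ℝ g y)‖ ≤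
        A * H * ‖f y‖ * ‖x - y‖ ^ ((γ : ℝ) - 3) := by
      refine (norm_flip_comp_le _ _ _).trans ?_
      calc ‖fderiv ℝ K (x - y)‖ * ‖f y‖ * ‖fderiv ℝ g x - fderiv ℝ g y‖
          ≤ A * (‖x - y‖ ^ 3)⁻¹ * ‖f y‖ * (H * ‖x - y‖ ^ (γ : ℝ)) := by
            gcongr
            · exact hK.norm_fderiv_le _ hne
            · exact hg.norm_sub_le x y
        _ = A * H * ‖f y‖ * (‖x - y‖ ^ (γ : ℝ) * (‖x - y‖ ^ 3)⁻¹) := by ring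
        _ = A * H * ‖f y‖ * ‖x - y‖ ^ ((γ : ℝ) - 3) := by rw [rpow_mul_inv_pow_three hpos]
    calc _ ≤ ‖((fderiv ℝ (fderiv ℝ K) (x - y)).flip (taylorRem g x y)).flip (f y)‖ +
          ‖((fderiv ℝ K (x - y)).flip (f y)).comp (fderiv ℝ g x - fderiv ℝ g y)‖ := norm_add_le _ _
      _ ≤ A * H * ‖f y‖ * ‖x - y‖ ^ ((γ : ℝ) - 3) + A * H * ‖f y‖ * ‖x - y‖ ^ ((γ : ℝ) - 3) :=
          add_le_add h1 h2
      _ = 2 * A * H * ‖f y‖ * ‖x - y‖ ^ ((γ : ℝ) - 3) := by ring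

/-- The same bound for the truncated derivative integrand, constant `A(2 + 2B)`. [folklore] -/
theorem norm_remGradIntegrandT_le (hK : IsC3SingularKernel K A) {B : ℝ} (hB0 : 0 ≤ B)
    (hB : ∀ ε : ℝ, 0 < ε → ∀ z : ℝ³, ‖fderiv ℝ (radialCutoff ε (2 * ε)) z‖ ≤ B * ε⁻¹)
    (hg : HolderGrad γ g H) {ε : ℝ} (hε : 0 < ε) (x y : ℝ³) :
    ‖remGradIntegrandT K g f ε x y‖ ≤ A * (2 + 2 * B) * H * ‖f y‖ * ‖x - y‖ ^ ((γ : ℝ) - 3) := by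
  have hA := hK.nonneg
  have hH := hg.nonneg
  rcases eq_or_ne x y with rfl | hxy
  · unfold remGradIntegrandT
    simp only [sub_self, taylorRem_self]
    have h1 := norm_flip_flip_le (fderiv ℝ (truncKernel (fderiv ℝ K) ε) 0) (0 : ℝ³) (f x)
    have h2 := norm_flip_comp_le (truncKernel (fderiv ℝ K) ε 0) (f x) (0 : ℝ³ →L[ℝ] ℝ³)
    rw [norm_zero, mul_zero, zero_mul] at h1
    rw [norm_zero, mul_zero] at h2
    refine ((norm_add_le _ _).trans (add_le_add h1 h2)).trans ?_
    rw [add_zero]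
    positivity
  · have hne : x - y ≠ 0 := sub_ne_zero.2 hxy
    have hpos : 0 < ‖x - y‖ := norm_pos_iff.2 hne
    unfold remGradIntegrandT
    have h1 : ‖((fderiv ℝ (truncKernel (fderiv ℝ K) ε) (x - y)).flip (taylorRem g x y)).flip (f y)‖ ≤
        A * (1 + 2 * B) * H * ‖f y‖ * ‖x - y‖ ^ ((γ : ℝ) - 3) := by
      refine (norm_flip_flip_le _ _ _).trans ?_
      calc ‖fderiv ℝ (truncKernel (fderiv ℝ K) ε) (x - y)‖ * ‖taylorRem g x y‖ * ‖f y‖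
          ≤ A * (1 + 2 * B) * (‖x - y‖ ^ 4)⁻¹ * (H * ‖x - y‖ ^ (1 + (γ : ℝ))) * ‖f y‖ := by
            gcongr
            · exact norm_fderiv_truncKernel_fderiv_le hK hB0 hB hε hne
            · exact hg.norm_taylorRem_le x y
        _ = A * (1 + 2 * B) * H * ‖f y‖ * (‖x - y‖ ^ (1 + (γ : ℝ)) * (‖x - y‖ ^ 4)⁻¹) := by ring
        _ = A * (1 + 2 * B) * H * ‖f y‖ * ‖x - y‖ ^ ((γ : ℝ) - 3) := by
            rw [rpow_one_add_mul_inv_pow_four hpos]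
    have h2 : ‖((truncKernel (fderiv ℝ K) ε (x - y)).flip (f y)).comp (fderiv ℝ g x - fderiv ℝ g y)‖ ≤
        A * H * ‖f y‖ * ‖x - y‖ ^ ((γ : ℝ) - 3) := by
      refine (norm_flip_comp_le _ _ _).trans ?_
      calc ‖truncKernel (fderiv ℝ K) ε (x - y)‖ * ‖f y‖ * ‖fderiv ℝ g x - fderiv ℝ g y‖
          ≤ A * (‖x - y‖ ^ 3)⁻¹ * ‖f y‖ * (H * ‖x - y‖ ^ (γ : ℝ)) := by
            gcongr
            · exact norm_truncKernel_fderiv_le hK.toIsC1SingularKernel hε _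
            · exact hg.norm_sub_le x y
        _ = A * H * ‖f y‖ * (‖x - y‖ ^ (γ : ℝ) * (‖x - y‖ ^ 3)⁻¹) := by ring
        _ = A * H * ‖f y‖ * ‖x - y‖ ^ ((γ : ℝ) - 3) := by rw [rpow_mul_inv_pow_three hpos]
    calc _ ≤ ‖((fderiv ℝ (truncKernel (fderiv ℝ K) ε) (x - y)).flip (taylorRem g x y)).flip (f y)‖ +
          ‖((truncKernel (fderiv ℝ K) ε (x - y)).flip (f y)).comp (fderiv ℝ g x - fderiv ℝ g y)‖ :=
          norm_add_le _ _
      _ ≤ A * (1 + 2 * B) * H * ‖f y‖ * ‖x - y‖ ^ ((γ : ℝ) - 3) +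
          A * H * ‖f y‖ * ‖x - y‖ ^ ((γ : ℝ) - 3) := add_le_add h1 h2
      _ = A * (2 + 2 * B) * H * ‖f y‖ * ‖x - y‖ ^ ((γ : ℝ) - 3) := by ring

end Pointwise


/-! ### Majorants adapted to a compactly supported density -/

section Majorant

variable {f : ℝ³ → V}

omit [NormedSpace ℝ V] in
/-- **The density-weighted power majorant**: for `f` supported in `B̄(c, R)`, bounded by `M`,
and an exponent `s < 3`,
`‖f y‖ |x − y|^{s−3} ≤ M (holderMajorant s (2R) (x − y) + (2R)^{s−3} 1_{B̄(c,R)}(y))`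
(near `x` the majorant, beyond `2R` the crude power bound on the support). [folklore] -/
theorem norm_mul_rpow_le_majorant {c : ℝ³} {R M : ℝ} (hR : 0 < R)
    (hsupp : tsupport f ⊆ closedBall c R) (hM : ∀ y, ‖f y‖ ≤ M) {s : ℝ} (hs : s < 3) (x y : ℝ³) :
    ‖f y‖ * ‖x - y‖ ^ (s - 3) ≤
      M * (holderMajorant s (2 * R) (x - y) +
        (2 * R) ^ (s - 3) * (closedBall c R).indicator (fun _ => (1 : ℝ)) y) := by
  have hM0 : 0 ≤ M := (norm_nonneg _).trans (hM y)
  have hind0 : 0 ≤ (2 * R) ^ (s - 3) * (closedBall c R).indicator (fun _ => (1 : ℝ)) y :=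
    mul_nonneg (by positivity) (indicator_nonneg (fun _ _ => zero_le_one) _)
  by_cases hfy : f y = 0
  · rw [hfy, norm_zero, zero_mul]
    exact mul_nonneg hM0 (add_nonneg (holderMajorant_nonneg _ _ _) hind0)
  · have hy : y ∈ closedBall c R := hsupp (subset_tsupport f (mem_support.2 hfy))
    by_cases hnear : ‖x - y‖ < 2 * R
    · have hmaj : holderMajorant s (2 * R) (x - y) = ‖x - y‖ ^ (s - 3) := by
        simp [holderMajorant, indicator, hnear]
      rw [hmaj]
      calc ‖f y‖ * ‖x - y‖ ^ (s - 3) ≤ M * ‖x - y‖ ^ (s - 3) := by gcongr; exact hM y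
        _ ≤ M * (‖x - y‖ ^ (s - 3) + (2 * R) ^ (s - 3) * (closedBall c R).indicator (fun _ => 1) y) := by
            gcongr
            exact le_add_of_nonneg_right hind0
    · have hfar : 2 * R ≤ ‖x - y‖ := not_lt.1 hnear
      have hpow : ‖x - y‖ ^ (s - 3) ≤ (2 * R) ^ (s - 3) :=
        Real.rpow_le_rpow_of_nonpos (by positivity) hfar (by linarith)
      rw [indicator_of_mem hy, mul_one]
      calc ‖f y‖ * ‖x - y‖ ^ (s - 3) ≤ M * (2 * R) ^ (s - 3) := by gcongr; exact hM y
        _ ≤ M * (holderMajorant s (2 * R) (x - y) + (2 * R) ^ (s - 3)) := by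
            gcongr
            exact le_add_of_nonneg_left (holderMajorant_nonneg _ _ _)

/-- The lower integral of the density-weighted power majorant:
`4π(2R)^s/s + (2R)^{s−3} (4/3)πR³`. [folklore] -/
theorem lintegral_majorant_support (c : ℝ³) {R : ℝ} (hR : 0 < R) {s : ℝ} (hs : 0 < s) (x : ℝ³) :
    ∫⁻ y, ENNReal.ofReal (holderMajorant s (2 * R) (x - y) +
        (2 * R) ^ (s - 3) * (closedBall c R).indicator (fun _ => (1 : ℝ)) y) =
      ENNReal.ofReal (4 * π * (2 * R) ^ s / s + (2 * R) ^ (s - 3) * (4 / 3 * π * R ^ 3)) := by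
  have h1 : ∀ y, 0 ≤ holderMajorant s (2 * R) (x - y) := fun y => holderMajorant_nonneg _ _ _
  have h2 : ∀ y, 0 ≤ (2 * R) ^ (s - 3) * (closedBall c R).indicator (fun _ => (1 : ℝ)) y := fun y =>
    mul_nonneg (by positivity) (indicator_nonneg (fun _ _ => zero_le_one) _)
  have hmeas : Measurable fun y => ENNReal.ofReal (holderMajorant s (2 * R) (x - y)) :=
    ((measurable_holderMajorant s (2 * R)).comp (measurable_const.sub measurable_id)).ennreal_ofReal
  simp_rw [ENNReal.ofReal_add (h1 _) (h2 _)]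
  rw [lintegral_add_left hmeas, lintegral_holderMajorant_sub_left hs (by positivity) x]
  simp_rw [ENNReal.ofReal_mul (by positivity : (0 : ℝ) ≤ (2 * R) ^ (s - 3))]
  rw [lintegral_const_mul' _ _ ENNReal.ofReal_ne_top, lintegral_indicator_closedBall hR.le,
    ← ENNReal.ofReal_mul (by positivity), ← ENNReal.ofReal_add (by positivity) (by positivity)]

end Majorant

/-! ### Measurability and integrability -/

section Integrable

variable {K : ℝ³ → V →L[ℝ] W} {A : ℝ} {γ : ℝ≥0} {g : ℝ³ → ℝ³} {H : ℝ} {f : ℝ³ → V}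

/-- `y ↦ x − y` maps `{x}ᶜ` into `{0}ᶜ`. [folklore] -/
theorem mapsTo_sub_compl (x : ℝ³) : MapsTo (fun y => x - y) {x}ᶜ {0}ᶜ := fun y hy => by
  simp only [mem_compl_iff, mem_singleton_iff] at hy ⊢
  exact sub_ne_zero.2 (Ne.symm hy)

/-- The remainder integrand is continuous in `y` off the diagonal. [folklore] -/
theorem continuousOn_remIntegrand (hK : IsC3SingularKernel K A) (hg : HolderGrad γ g H) (hγ : 0 < γ)
    (hf : Continuous f) (x : ℝ³) : ContinuousOn (remIntegrand K g f x) {x}ᶜ := by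
  have h1 : ContinuousOn (fun y => fderiv ℝ K (x - y)) {x}ᶜ :=
    hK.continuousOn_fderiv'.comp (continuous_const.sub continuous_id).continuousOn (mapsTo_sub_compl x)
  exact (h1.clm_apply (hg.continuous_taylorRem hγ x).continuousOn).clm_apply hf.continuousOn

/-- The remainder integrand is a.e. strongly measurable in `y`. [folklore] -/
theorem aestronglyMeasurable_remIntegrand (hK : IsC3SingularKernel K A) (hg : HolderGrad γ g H)
    (hγ : 0 < γ) (hf : Continuous f) (x : ℝ³) :
    AEStronglyMeasurable (remIntegrand K g f x) volume := by
  have h := (continuousOn_remIntegrand hK hg hγ hf x).aestronglyMeasurable (μ := volume)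
    (measurableSet_singleton x).compl
  rwa [restrict_compl_singleton] at h

/-- The derivative integrand is continuous in `y` off the diagonal. [folklore] -/
theorem continuousOn_remGradIntegrand (hK : IsC3SingularKernel K A) (hg : HolderGrad γ g H)
    (hγ : 0 < γ) (hf : Continuous f) (x : ℝ³) : ContinuousOn (remGradIntegrand K g f x) {x}ᶜ := by
  have h1 : ContinuousOn (fun y => fderiv ℝ K (x - y)) {x}ᶜ :=
    hK.continuousOn_fderiv'.comp (continuous_const.sub continuous_id).continuousOn (mapsTo_sub_compl x)
  have h2 : ContinuousOn (fun y => fderiv ℝ (fderiv ℝ K) (x - y)) {x}ᶜ :=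
    hK.continuousOn_fderiv₂.comp (continuous_const.sub continuous_id).continuousOn (mapsTo_sub_compl x)
  have h3 : ContinuousOn (fun y => ((fderiv ℝ (fderiv ℝ K) (x - y)).flip (taylorRem g x y)).flip (f y))
      {x}ᶜ := by
    have h4 : ContinuousOn (fun y => (fderiv ℝ (fderiv ℝ K) (x - y)).flip (taylorRem g x y)) {x}ᶜ :=
      ((ContinuousLinearMap.flipₗᵢ ℝ ℝ³ ℝ³ (V →L[ℝ] W)).continuous.comp_continuousOn h2).clm_apply
        (hg.continuous_taylorRem hγ x).continuousOn
    exact ((ContinuousLinearMap.flipₗᵢ ℝ ℝ³ V W).continuous.comp_continuousOn h4).clm_apply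
      hf.continuousOn
  have h5 : ContinuousOn (fun y => ((fderiv ℝ K (x - y)).flip (f y)).comp (fderiv ℝ g x - fderiv ℝ g y))
      {x}ᶜ := by
    have h6 : ContinuousOn (fun y => (fderiv ℝ K (x - y)).flip (f y)) {x}ᶜ :=
      ((ContinuousLinearMap.flipₗᵢ ℝ ℝ³ V W).continuous.comp_continuousOn h1).clm_apply hf.continuousOn
    exact h6.clm_comp (continuous_const.sub (hg.continuous_fderiv hγ)).continuousOn
  exact h3.add h5

/-- The derivative integrand is a.e. strongly measurable in `y`. [folklore] -/
theorem aestronglyMeasurable_remGradIntegrand (hK : IsC3SingularKernel K A) (hg : HolderGrad γ g H)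
    (hγ : 0 < γ) (hf : Continuous f) (x : ℝ³) :
    AEStronglyMeasurable (remGradIntegrand K g f x) volume := by
  have h := (continuousOn_remGradIntegrand hK hg hγ hf x).aestronglyMeasurable (μ := volume)
    (measurableSet_singleton x).compl
  rwa [restrict_compl_singleton] at h

/-- The truncated remainder integrand is continuous in `y`. [folklore] -/
theorem continuous_remIntegrandT (hK : IsC3SingularKernel K A) (hg : HolderGrad γ g H) (hγ : 0 < γ)
    (hf : Continuous f) {ε : ℝ} (hε : 0 < ε) (x : ℝ³) : Continuous (remIntegrandT K g f ε x) := by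
  have h1 : Continuous fun y => truncKernel (fderiv ℝ K) ε (x - y) :=
    (contDiff_truncKernel_fderiv hK hε).continuous.comp (continuous_const.sub continuous_id)
  exact (h1.clm_apply (hg.continuous_taylorRem hγ x)).clm_apply hf

/-- The truncated derivative integrand is continuous in `y`. [folklore] -/
theorem continuous_remGradIntegrandT (hK : IsC3SingularKernel K A) (hg : HolderGrad γ g H)
    (hγ : 0 < γ) (hf : Continuous f) {ε : ℝ} (hε : 0 < ε) (x : ℝ³) :
    Continuous (remGradIntegrandT K g f ε x) := by
  have hP : ContDiff ℝ 1 (truncKernel (fderiv ℝ K) ε) := contDiff_truncKernel_fderiv hK hε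
  have h1 : Continuous fun y => truncKernel (fderiv ℝ K) ε (x - y) :=
    hP.continuous.comp (continuous_const.sub continuous_id)
  have h2 : Continuous fun y => fderiv ℝ (truncKernel (fderiv ℝ K) ε) (x - y) :=
    (hP.continuous_fderiv one_ne_zero).comp (continuous_const.sub continuous_id)
  have h3 : Continuous fun y =>
      ((fderiv ℝ (truncKernel (fderiv ℝ K) ε) (x - y)).flip (taylorRem g x y)).flip (f y) := by
    have h4 : Continuous fun y => (fderiv ℝ (truncKernel (fderiv ℝ K) ε) (x - y)).flip (taylorRem g x y) :=
      ((ContinuousLinearMap.flipₗᵢ ℝ ℝ³ ℝ³ (V →L[ℝ] W)).continuous.comp h2).clm_apply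
        (hg.continuous_taylorRem hγ x)
    exact ((ContinuousLinearMap.flipₗᵢ ℝ ℝ³ V W).continuous.comp h4).clm_apply hf
  have h5 : Continuous fun y =>
      ((truncKernel (fderiv ℝ K) ε (x - y)).flip (f y)).comp (fderiv ℝ g x - fderiv ℝ g y) := by
    have h6 : Continuous fun y => (truncKernel (fderiv ℝ K) ε (x - y)).flip (f y) :=
      ((ContinuousLinearMap.flipₗᵢ ℝ ℝ³ V W).continuous.comp h1).clm_apply hf
    exact h6.clm_comp (continuous_const.sub (hg.continuous_fderiv hγ))
  exact h3.add h5

/-- The truncated integrands vanish where the density does. [folklore] -/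
theorem remIntegrandT_eq_zero {ε : ℝ} {x y : ℝ³} (hy : f y = 0) : remIntegrandT K g f ε x y = 0 := by
  simp [remIntegrandT, hy]

/-- The truncated derivative integrands vanish where the density does. [folklore] -/
theorem remGradIntegrandT_eq_zero {ε : ℝ} {x y : ℝ³} (hy : f y = 0) :
    remGradIntegrandT K g f ε x y = 0 := by
  simp [remGradIntegrandT, hy]

/-- The truncated remainder integrand has compact support in `y`. [folklore] -/
theorem hasCompactSupport_remIntegrandT (hfc : HasCompactSupport f) (ε : ℝ) (x : ℝ³) :
    HasCompactSupport (remIntegrandT K g f ε x) :=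
  hfc.mono fun y hy => by
    contrapose! hy
    rw [notMem_support] at hy ⊢
    exact remIntegrandT_eq_zero hy

/-- The truncated derivative integrand has compact support in `y`. [folklore] -/
theorem hasCompactSupport_remGradIntegrandT (hfc : HasCompactSupport f) (ε : ℝ) (x : ℝ³) :
    HasCompactSupport (remGradIntegrandT K g f ε x) :=
  hfc.mono fun y hy => by
    contrapose! hy
    rw [notMem_support] at hy ⊢
    exact remGradIntegrandT_eq_zero hy

variable {c : ℝ³} {R M : ℝ}

omit [NormedSpace ℝ V] in
/-- A density supported in `B̄(c, R)` has compact support. [folklore] -/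
theorem hasCompactSupport_of_tsupport_subset (hsupp : tsupport f ⊆ closedBall c R) : HasCompactSupport f :=
  HasCompactSupport.of_support_subset_isCompact (isCompact_closedBall c R)
    ((subset_tsupport f).trans hsupp)

/-- **Domination of the remainder integrand** by the density-weighted majorant with `s = γ + 1`. [folklore] -/
theorem norm_remIntegrand_le_majorant (hK : IsC1SingularKernel K A) (hg : HolderGrad γ g H)
    (hγ1 : (γ : ℝ) < 1) (hR : 0 < R) (hsupp : tsupport f ⊆ closedBall c R) (hM : ∀ y, ‖f y‖ ≤ M)
    (x y : ℝ³) :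
    ‖remIntegrand K g f x y‖ ≤ A * H * M * (holderMajorant ((γ : ℝ) + 1) (2 * R) (x - y) +
      (2 * R) ^ ((γ : ℝ) + 1 - 3) * (closedBall c R).indicator (fun _ => (1 : ℝ)) y) := by
  have h1 := norm_remIntegrand_le (f := f) hK hg x y
  have h2 := norm_mul_rpow_le_majorant hR hsupp hM (s := (γ : ℝ) + 1) (by linarith) x y
  rw [show (γ : ℝ) + 1 - 3 = (γ : ℝ) - 2 by ring] at h2 ⊢
  calc ‖remIntegrand K g f x y‖ ≤ A * H * (‖f y‖ * ‖x - y‖ ^ ((γ : ℝ) - 2)) := by rw [← mul_assoc]; exact h1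
    _ ≤ A * H * (M * _) := by gcongr; exact mul_nonneg hK.nonneg hg.nonneg
    _ = _ := by ring

/-- **Domination of the derivative integrand** by the density-weighted majorant with `s = γ`. [folklore] -/
theorem norm_remGradIntegrand_le_majorant (hK : IsC3SingularKernel K A) (hg : HolderGrad γ g H)
    (hγ1 : (γ : ℝ) < 1) (hR : 0 < R) (hsupp : tsupport f ⊆ closedBall c R) (hM : ∀ y, ‖f y‖ ≤ M)
    (x y : ℝ³) :
    ‖remGradIntegrand K g f x y‖ ≤ 2 * A * H * M * (holderMajorant (γ : ℝ) (2 * R) (x - y) +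
      (2 * R) ^ ((γ : ℝ) - 3) * (closedBall c R).indicator (fun _ => (1 : ℝ)) y) := by
  have h1 := norm_remGradIntegrand_le (f := f) hK hg x y
  have h2 := norm_mul_rpow_le_majorant hR hsupp hM (s := (γ : ℝ)) (by linarith) x y
  calc ‖remGradIntegrand K g f x y‖ ≤ 2 * A * H * (‖f y‖ * ‖x - y‖ ^ ((γ : ℝ) - 3)) := by
        rw [← mul_assoc]; exact h1
    _ ≤ 2 * A * H * (M * _) := by
        gcongr
        exact mul_nonneg (mul_nonneg zero_le_two hK.nonneg) hg.nonneg
    _ = _ := by ring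

/-- The truncated remainder integrand is dominated by the same majorant. [folklore] -/
theorem norm_remIntegrandT_le_majorant (hK : IsC1SingularKernel K A) (hg : HolderGrad γ g H)
    (hγ1 : (γ : ℝ) < 1) (hR : 0 < R) (hsupp : tsupport f ⊆ closedBall c R) (hM : ∀ y, ‖f y‖ ≤ M)
    {ε : ℝ} (hε : 0 < ε) (x y : ℝ³) :
    ‖remIntegrandT K g f ε x y‖ ≤ A * H * M * (holderMajorant ((γ : ℝ) + 1) (2 * R) (x - y) +
      (2 * R) ^ ((γ : ℝ) + 1 - 3) * (closedBall c R).indicator (fun _ => (1 : ℝ)) y) := by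
  have h1 := norm_remIntegrandT_le (f := f) hK hg hε x y
  have h2 := norm_mul_rpow_le_majorant hR hsupp hM (s := (γ : ℝ) + 1) (by linarith) x y
  rw [show (γ : ℝ) + 1 - 3 = (γ : ℝ) - 2 by ring] at h2 ⊢
  calc ‖remIntegrandT K g f ε x y‖ ≤ A * H * (‖f y‖ * ‖x - y‖ ^ ((γ : ℝ) - 2)) := by
        rw [← mul_assoc]; exact h1
    _ ≤ A * H * (M * _) := by gcongr; exact mul_nonneg hK.nonneg hg.nonneg
    _ = _ := by ring

omit [NormedSpace ℝ V] in
/-- The density-weighted majorant is integrable in `y`. [folklore] -/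
theorem integrable_majorant_support (c : ℝ³) (R : ℝ) {s : ℝ} (hs : 0 < s) (x : ℝ³) :
    Integrable fun y => holderMajorant s (2 * R) (x - y) +
      (2 * R) ^ (s - 3) * (closedBall c R).indicator (fun _ => (1 : ℝ)) y := by
  refine Integrable.add ((integrable_holderMajorant hs (2 * R)).comp_sub_left x) ?_
  refine Integrable.const_mul ?_ _
  rw [integrable_indicator_iff measurableSet_closedBall]
  exact continuousOn_const.integrableOn_compact (isCompact_closedBall c R)

/-- **The remainder integrand is integrable** (absolute convergence: kernel `O(|x − y|^{γ−2})`). [folklore] -/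
theorem integrable_remIntegrand (hK : IsC3SingularKernel K A) (hg : HolderGrad γ g H) (hγ : 0 < γ)
    (hγ1 : (γ : ℝ) < 1) (hf : Continuous f) (hR : 0 < R) (hsupp : tsupport f ⊆ closedBall c R)
    (hM : ∀ y, ‖f y‖ ≤ M) (x : ℝ³) : Integrable (remIntegrand K g f x) := by
  refine Integrable.mono' (((integrable_majorant_support c R (s := (γ : ℝ) + 1) (by positivity) x)).const_mul
    (A * H * M)) (aestronglyMeasurable_remIntegrand hK hg hγ hf x) (Eventually.of_forall fun y => ?_)
  exact norm_remIntegrand_le_majorant hK.toIsC1SingularKernel hg hγ1 hR hsupp hM x y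

/-- **The derivative integrand is integrable** (kernel `O(|x − y|^{γ−3})`, `γ > 0`). [folklore] -/
theorem integrable_remGradIntegrand (hK : IsC3SingularKernel K A) (hg : HolderGrad γ g H) (hγ : 0 < γ)
    (hγ1 : (γ : ℝ) < 1) (hf : Continuous f) (hR : 0 < R) (hsupp : tsupport f ⊆ closedBall c R)
    (hM : ∀ y, ‖f y‖ ≤ M) (x : ℝ³) : Integrable (remGradIntegrand K g f x) := by
  refine Integrable.mono' (((integrable_majorant_support c R (s := (γ : ℝ)) (by exact_mod_cast hγ) x)).const_mul
    (2 * A * H * M)) (aestronglyMeasurable_remGradIntegrand hK hg hγ hf x) (Eventually.of_forall fun y => ?_)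
  exact norm_remGradIntegrand_le_majorant hK hg hγ1 hR hsupp hM x y

/-- The truncated remainder integrand is integrable. [folklore] -/
theorem integrable_remIntegrandT (hK : IsC3SingularKernel K A) (hg : HolderGrad γ g H) (hγ : 0 < γ)
    (hf : Continuous f) (hfc : HasCompactSupport f) {ε : ℝ} (hε : 0 < ε) (x : ℝ³) :
    Integrable (remIntegrandT K g f ε x) :=
  (continuous_remIntegrandT hK hg hγ hf hε x).integrable_of_hasCompactSupport
    (hasCompactSupport_remIntegrandT hfc ε x)

/-- The truncated derivative integrand is integrable. [folklore] -/
theorem integrable_remGradIntegrandT (hK : IsC3SingularKernel K A) (hg : HolderGrad γ g H) (hγ : 0 < γ)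
    (hf : Continuous f) (hfc : HasCompactSupport f) {ε : ℝ} (hε : 0 < ε) (x : ℝ³) :
    Integrable (remGradIntegrandT K g f ε x) :=
  (continuous_remGradIntegrandT hK hg hγ hf hε x).integrable_of_hasCompactSupport
    (hasCompactSupport_remGradIntegrandT hfc ε x)

/-! ### Sup bounds, uniform in `x` -/

/-- **Sup bound of the remainder**:
`‖Rem(x)‖ ≤ A H M (4π(2R)^{γ+1}/(γ+1) + (2R)^{γ−2} (4/3)πR³)` for all `x`. [cite: MajdaBertozziCUP2002, §4.5 Lemma 4.10, the estimate of |G₂(X)Y|₀ (p. 146)] -/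
theorem norm_remPotential_le (hK : IsC1SingularKernel K A) (hg : HolderGrad γ g H) (hγ : 0 < γ)
    (hγ1 : (γ : ℝ) < 1) (hR : 0 < R) (hsupp : tsupport f ⊆ closedBall c R) (hM : ∀ y, ‖f y‖ ≤ M)
    (x : ℝ³) :
    ‖remPotential K g f x‖ ≤ A * H * M *
      (4 * π * (2 * R) ^ ((γ : ℝ) + 1) / ((γ : ℝ) + 1) + (2 * R) ^ ((γ : ℝ) + 1 - 3) * (4 / 3 * π * R ^ 3)) := by
  have hM0 : 0 ≤ M := (norm_nonneg _).trans (hM x)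
  refine norm_integral_le_of_le_majorant (mul_nonneg (mul_nonneg hK.nonneg hg.nonneg) hM0)
    (by positivity) (le_of_eq (lintegral_majorant_support c hR (by positivity) x)) fun y => ?_
  exact norm_remIntegrand_le_majorant hK hg hγ1 hR hsupp hM x y

/-- **Sup bound of the derivative**:
`‖remGrad x‖ ≤ 2 A H M (4π(2R)^γ/γ + (2R)^{γ−3} (4/3)πR³)` for all `x`. [folklore] -/
theorem norm_remGrad_le (hK : IsC3SingularKernel K A) (hg : HolderGrad γ g H) (hγ : 0 < γ)
    (hγ1 : (γ : ℝ) < 1) (hR : 0 < R) (hsupp : tsupport f ⊆ closedBall c R) (hM : ∀ y, ‖f y‖ ≤ M)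
    (x : ℝ³) :
    ‖remGrad K g f x‖ ≤ 2 * A * H * M *
      (4 * π * (2 * R) ^ (γ : ℝ) / (γ : ℝ) + (2 * R) ^ ((γ : ℝ) - 3) * (4 / 3 * π * R ^ 3)) := by
  have hM0 : 0 ≤ M := (norm_nonneg _).trans (hM x)
  have hγ' : (0 : ℝ) < γ := by exact_mod_cast hγ
  refine norm_integral_le_of_le_majorant
    (mul_nonneg (mul_nonneg (mul_nonneg zero_le_two hK.nonneg) hg.nonneg) hM0)
    (by positivity) (le_of_eq (lintegral_majorant_support c hR hγ' x)) fun y => ?_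
  exact norm_remGradIntegrand_le_majorant hK hg hγ1 hR hsupp hM x y




/-! ### Differentiation of the truncated remainder under the integral sign -/

/-- **The truncated integrand is differentiable in `x` with derivative the truncated derivative
integrand** (chain rule for `x ↦ P_ε(x − y)`, `∇ₓ r(x, y) = ∇g(x) − ∇g(y)`, and the product
rule `HasFDerivAt.clm_apply`). [folklore] -/
theorem hasFDerivAt_remIntegrandT (hK : IsC3SingularKernel K A) (hg : HolderGrad γ g H) {ε : ℝ}
    (hε : 0 < ε) (x y : ℝ³) :
    HasFDerivAt (fun x => remIntegrandT K g f ε x y) (remGradIntegrandT K g f ε x y) x := by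
  set P := truncKernel (fderiv ℝ K) ε with hP
  have hPd : Differentiable ℝ P := (contDiff_truncKernel_fderiv hK hε).differentiable one_ne_zero
  -- `x ↦ P (x - y)`
  have h1 : HasFDerivAt (fun x : ℝ³ => P (x - y)) (fderiv ℝ P (x - y)) x := by
    have h := (hPd (x - y)).hasFDerivAt.comp x ((hasFDerivAt_id x).sub_const y)
    rwa [ContinuousLinearMap.comp_id] at h
  -- `x ↦ P (x - y) (r x y)`
  have h2 : HasFDerivAt (fun x : ℝ³ => P (x - y) (taylorRem g x y))
      ((P (x - y)).comp (fderiv ℝ g x - fderiv ℝ g y) + (fderiv ℝ P (x - y)).flip (taylorRem g x y)) x :=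
    h1.clm_apply (hg.hasFDerivAt_taylorRem x y)
  -- `x ↦ P (x - y) (r x y) (f y)`
  have h3 : HasFDerivAt (fun x : ℝ³ => P (x - y) (taylorRem g x y) (f y))
      ((P (x - y) (taylorRem g x y)).comp (0 : ℝ³ →L[ℝ] V) +
        ((P (x - y)).comp (fderiv ℝ g x - fderiv ℝ g y) +
          (fderiv ℝ P (x - y)).flip (taylorRem g x y)).flip (f y)) x :=
    h2.clm_apply (hasFDerivAt_const (f y) x)
  refine h3.congr_fderiv ?_
  ext e
  simp only [remGradIntegrandT, hP, ContinuousLinearMap.comp_zero, zero_add, add_apply,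
    ContinuousLinearMap.flip_apply, ContinuousLinearMap.comp_apply]
  abel

/-- **The truncated remainder is differentiable with derivative under the integral sign**
(dominated differentiation on the unit ball around `x₀`; the derivative integrand is bounded
there by an `ε`-dependent constant times `‖f y‖`). [folklore] -/
theorem hasFDerivAt_remPotentialT (hK : IsC3SingularKernel K A) (hg : HolderGrad γ g H) (hγ : 0 < γ)
    (hf : Continuous f) (hsupp : tsupport f ⊆ closedBall c R) {ε : ℝ} (hε : 0 < ε) (x₀ : ℝ³) :
    HasFDerivAt (remPotentialT K g f ε) (remGradT K g f ε x₀) x₀ := by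
  obtain ⟨B, hB0, hB⟩ := exists_norm_fderiv_radialCutoff_le
  have hfc : HasCompactSupport f := hasCompactSupport_of_tsupport_subset hsupp
  have hA := hK.nonneg
  have hH := hg.nonneg
  set L : ℝ := 1 + ‖x₀ - c‖ + |R| with hL
  have hL0 : 0 ≤ L := by positivity
  set Cε : ℝ := A * (1 + 2 * B) * (ε ^ 4)⁻¹ * (H * L ^ (1 + (γ : ℝ))) +
    A * (ε ^ 3)⁻¹ * (H * L ^ (γ : ℝ)) with hCε
  unfold remPotentialT remGradT
  refine hasFDerivAt_integral_of_dominated_of_fderiv_le (𝕜 := ℝ) (μ := volume)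
    (F := fun x y => remIntegrandT K g f ε x y) (F' := fun x y => remGradIntegrandT K g f ε x y)
    (bound := fun y => Cε * ‖f y‖) (ball_mem_nhds x₀ one_pos) ?_ ?_ ?_ ?_ ?_ ?_
  · exact Eventually.of_forall fun x => (continuous_remIntegrandT hK hg hγ hf hε x).aestronglyMeasurable
  · exact integrable_remIntegrandT hK hg hγ hf hfc hε x₀
  · exact (continuous_remGradIntegrandT hK hg hγ hf hε x₀).aestronglyMeasurable
  · refine Eventually.of_forall fun y x hx => ?_
    rw [mem_ball_iff_norm] at hx
    by_cases hfy : f y = 0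
    · rw [remGradIntegrandT_eq_zero hfy, norm_zero, hfy, norm_zero, mul_zero]
    · -- `y` lies in the support ball, so `‖x - y‖ ≤ L`
      have hy : ‖y - c‖ ≤ R := by
        have := hsupp (subset_tsupport f (mem_support.2 hfy))
        rwa [mem_closedBall, dist_eq_norm] at this
      have hxy : ‖x - y‖ ≤ L := by
        have h1 : ‖x - y‖ ≤ ‖x - x₀‖ + ‖x₀ - c‖ + ‖c - y‖ := by
          calc ‖x - y‖ = ‖(x - x₀) + (x₀ - c) + (c - y)‖ := by congr 1; abel
            _ ≤ ‖x - x₀‖ + ‖x₀ - c‖ + ‖c - y‖ := norm_add₃_le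
        rw [norm_sub_rev c y] at h1
        linarith [le_abs_self R]
      unfold remGradIntegrandT
      have e1 : ‖((fderiv ℝ (truncKernel (fderiv ℝ K) ε) (x - y)).flip (taylorRem g x y)).flip (f y)‖ ≤
          A * (1 + 2 * B) * (ε ^ 4)⁻¹ * (H * L ^ (1 + (γ : ℝ))) * ‖f y‖ := by
        refine (norm_flip_flip_le _ _ _).trans ?_
        gcongr
        · exact norm_fderiv_truncKernel_fderiv_le_const hK hB0 hB hε _
        · exact (hg.norm_taylorRem_le x y).trans (by gcongr)
      have e2 : ‖((truncKernel (fderiv ℝ K) ε (x - y)).flip (f y)).comp (fderiv ℝ g x - fderiv ℝ g y)‖ ≤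
          A * (ε ^ 3)⁻¹ * ‖f y‖ * (H * L ^ (γ : ℝ)) := by
        refine (norm_flip_comp_le _ _ _).trans ?_
        gcongr
        · exact norm_truncKernel_fderiv_le_const hK.toIsC1SingularKernel hε _
        · exact (hg.norm_sub_le x y).trans (by gcongr)
      calc _ ≤ ‖((fderiv ℝ (truncKernel (fderiv ℝ K) ε) (x - y)).flip (taylorRem g x y)).flip (f y)‖ +
            ‖((truncKernel (fderiv ℝ K) ε (x - y)).flip (f y)).comp (fderiv ℝ g x - fderiv ℝ g y)‖ :=
            norm_add_le _ _
        _ ≤ A * (1 + 2 * B) * (ε ^ 4)⁻¹ * (H * L ^ (1 + (γ : ℝ))) * ‖f y‖ +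
            A * (ε ^ 3)⁻¹ * ‖f y‖ * (H * L ^ (γ : ℝ)) := add_le_add e1 e2
        _ = Cε * ‖f y‖ := by rw [hCε]; ring
  · exact ((hf.norm).const_mul Cε).integrable_of_hasCompactSupport hfc.norm.mul_left
  · exact Eventually.of_forall fun y x _ => hasFDerivAt_remIntegrandT hK hg hε x y

/-! ### Uniform approximation by the truncations -/

/-- For `2ε < ‖z‖` the truncated derivative kernel agrees with `∇K` near `z`. [folklore] -/
theorem truncKernel_fderiv_eventuallyEq {ε : ℝ} (hε : 0 < ε) {z : ℝ³} (hz : 2 * ε < ‖z‖) :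
    truncKernel (fderiv ℝ K) ε =ᶠ[𝓝 z] fderiv ℝ K := by
  filter_upwards [radialCutoff_eventuallyEq_zero (E := ℝ³) hε.le (by linarith) hz] with w hw
  rw [truncKernel, hw]
  simp

/-- **Uniform distance of the truncated remainder**: `‖Rem_ε(x) − Rem(x)‖ ≤ 2AHM · 4π(3ε)^{γ+1}/(γ+1)`
(the integrands agree off `‖x − y‖ ≤ 2ε` and are both `≤ AHM|x − y|^{γ−2}` there). [folklore] -/
theorem norm_remPotentialT_sub_le (hK : IsC3SingularKernel K A) (hg : HolderGrad γ g H) (hγ : 0 < γ)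
    (hγ1 : (γ : ℝ) < 1) (hf : Continuous f) (hR : 0 < R) (hsupp : tsupport f ⊆ closedBall c R)
    (hM : ∀ y, ‖f y‖ ≤ M) {ε : ℝ} (hε : 0 < ε) (x : ℝ³) :
    ‖remPotentialT K g f ε x - remPotential K g f x‖ ≤
      2 * A * H * M * (4 * π * (3 * ε) ^ ((γ : ℝ) + 1) / ((γ : ℝ) + 1)) := by
  have hA := hK.nonneg
  have hH := hg.nonneg
  have hM0 : 0 ≤ M := (norm_nonneg _).trans (hM x)
  have hfc : HasCompactSupport f := hasCompactSupport_of_tsupport_subset hsupp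
  rw [remPotentialT, remPotential, ← integral_sub (integrable_remIntegrandT hK hg hγ hf hfc hε x)
    (integrable_remIntegrand hK hg hγ hγ1 hf hR hsupp hM x)]
  refine norm_integral_le_of_le_majorant (by positivity) (by positivity)
    (le_of_eq (lintegral_holderMajorant_sub_left (γ := (γ : ℝ) + 1) (by positivity) (by positivity) x))
    fun y => ?_
  by_cases hfar : 2 * ε < ‖x - y‖
  · have heq : remIntegrandT K g f ε x y = remIntegrand K g f x y := by
      rw [remIntegrandT, remIntegrand, truncKernel_eq _ hε hfar.le]
    rw [heq, sub_self, norm_zero]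
    exact mul_nonneg (by positivity) (holderMajorant_nonneg _ _ _)
  · have hnear : ‖x - y‖ < 3 * ε := by linarith [not_lt.1 hfar]
    have hmaj : holderMajorant ((γ : ℝ) + 1) (3 * ε) (x - y) = ‖x - y‖ ^ ((γ : ℝ) + 1 - 3) := by
      simp [holderMajorant, indicator, hnear]
    rw [hmaj, show (γ : ℝ) + 1 - 3 = (γ : ℝ) - 2 by ring]
    have h1 := norm_remIntegrandT_le (f := f) hK.toIsC1SingularKernel hg hε x y
    have h2 := norm_remIntegrand_le (f := f) hK.toIsC1SingularKernel hg x y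
    calc ‖remIntegrandT K g f ε x y - remIntegrand K g f x y‖
        ≤ ‖remIntegrandT K g f ε x y‖ + ‖remIntegrand K g f x y‖ := norm_sub_le _ _
      _ ≤ A * H * ‖f y‖ * ‖x - y‖ ^ ((γ : ℝ) - 2) + A * H * ‖f y‖ * ‖x - y‖ ^ ((γ : ℝ) - 2) :=
          add_le_add h1 h2
      _ ≤ A * H * M * ‖x - y‖ ^ ((γ : ℝ) - 2) + A * H * M * ‖x - y‖ ^ ((γ : ℝ) - 2) := by
          gcongr <;> exact hM y
      _ = 2 * A * H * M * ‖x - y‖ ^ ((γ : ℝ) - 2) := by ring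

/-- **Uniform distance of the truncated derivative**:
`‖remGrad_ε(x) − remGrad(x)‖ ≤ A(4 + 2B) H M · 4π(3ε)^γ/γ`. [folklore] -/
theorem norm_remGradT_sub_le (hK : IsC3SingularKernel K A) {B : ℝ} (hB0 : 0 ≤ B)
    (hB : ∀ ε : ℝ, 0 < ε → ∀ z : ℝ³, ‖fderiv ℝ (radialCutoff ε (2 * ε)) z‖ ≤ B * ε⁻¹)
    (hg : HolderGrad γ g H) (hγ : 0 < γ) (hγ1 : (γ : ℝ) < 1) (hf : Continuous f) (hR : 0 < R)
    (hsupp : tsupport f ⊆ closedBall c R) (hM : ∀ y, ‖f y‖ ≤ M) {ε : ℝ} (hε : 0 < ε) (x : ℝ³) :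
    ‖remGradT K g f ε x - remGrad K g f x‖ ≤
      A * (4 + 2 * B) * H * M * (4 * π * (3 * ε) ^ (γ : ℝ) / (γ : ℝ)) := by
  have hA := hK.nonneg
  have hH := hg.nonneg
  have hM0 : 0 ≤ M := (norm_nonneg _).trans (hM x)
  have hγ' : (0 : ℝ) < γ := by exact_mod_cast hγ
  have hfc : HasCompactSupport f := hasCompactSupport_of_tsupport_subset hsupp
  rw [remGradT, remGrad, ← integral_sub (integrable_remGradIntegrandT hK hg hγ hf hfc hε x)
    (integrable_remGradIntegrand hK hg hγ hγ1 hf hR hsupp hM x)]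
  refine norm_integral_le_of_le_majorant (by positivity) (by positivity)
    (le_of_eq (lintegral_holderMajorant_sub_left hγ' (by positivity) x)) fun y => ?_
  by_cases hfar : 2 * ε < ‖x - y‖
  · have heq : remGradIntegrandT K g f ε x y = remGradIntegrand K g f x y := by
      rw [remGradIntegrandT, remGradIntegrand, truncKernel_eq _ hε hfar.le,
        (truncKernel_fderiv_eventuallyEq hε hfar).fderiv_eq]
    rw [heq, sub_self, norm_zero]
    exact mul_nonneg (by positivity) (holderMajorant_nonneg _ _ _)
  · have hnear : ‖x - y‖ < 3 * ε := by linarith [not_lt.1 hfar]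
    have hmaj : holderMajorant (γ : ℝ) (3 * ε) (x - y) = ‖x - y‖ ^ ((γ : ℝ) - 3) := by
      simp [holderMajorant, indicator, hnear]
    rw [hmaj]
    have h1 := norm_remGradIntegrandT_le (f := f) hK hB0 hB hg hε x y
    have h2 := norm_remGradIntegrand_le (f := f) hK hg x y
    calc ‖remGradIntegrandT K g f ε x y - remGradIntegrand K g f x y‖
        ≤ ‖remGradIntegrandT K g f ε x y‖ + ‖remGradIntegrand K g f x y‖ := norm_sub_le _ _
      _ ≤ A * (2 + 2 * B) * H * ‖f y‖ * ‖x - y‖ ^ ((γ : ℝ) - 3) +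
          2 * A * H * ‖f y‖ * ‖x - y‖ ^ ((γ : ℝ) - 3) := add_le_add h1 h2
      _ ≤ A * (2 + 2 * B) * H * M * ‖x - y‖ ^ ((γ : ℝ) - 3) +
          2 * A * H * M * ‖x - y‖ ^ ((γ : ℝ) - 3) := by gcongr <;> exact hM y
      _ = A * (4 + 2 * B) * H * M * ‖x - y‖ ^ ((γ : ℝ) - 3) := by ring

/-- **The remainder is differentiable, with derivative `remGrad`** (uniform limit of the
truncations `Rem_{1/(n+1)}`, Mathlib `hasFDerivAt_of_tendstoUniformly`). [cite: MajdaBertozziCUP2002, §4.5 Lemma 4.10 (p. 146–147)] -/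
theorem hasFDerivAt_remPotential (hK : IsC3SingularKernel K A) (hg : HolderGrad γ g H) (hγ : 0 < γ)
    (hγ1 : (γ : ℝ) < 1) (hf : Continuous f) (hR : 0 < R) (hsupp : tsupport f ⊆ closedBall c R)
    (hM : ∀ y, ‖f y‖ ≤ M) (x : ℝ³) :
    HasFDerivAt (remPotential K g f) (remGrad K g f x) x := by
  obtain ⟨B, hB0, hB⟩ := exists_norm_fderiv_radialCutoff_le
  have hA := hK.nonneg
  have hH := hg.nonneg
  have hM0 : 0 ≤ M := (norm_nonneg _).trans (hM x)
  have hγ' : (0 : ℝ) < γ := by exact_mod_cast hγ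
  set εs : ℕ → ℝ := fun n => 1 / ((n : ℝ) + 1) with hεs
  have hεpos : ∀ n, 0 < εs n := fun n => by positivity
  have hεt : Tendsto εs atTop (𝓝 0) := by
    simpa using tendsto_one_div_add_atTop_nhds_zero_nat
  -- rates
  have hrate : ∀ p : ℝ, 0 < p → Tendsto (fun n => (3 * εs n) ^ p) atTop (𝓝 0) := by
    intro p hp
    have h3 : Tendsto (fun n => 3 * εs n) atTop (𝓝 0) := by simpa using hεt.const_mul 3
    have hc := (Real.continuousAt_rpow_const 0 p (Or.inr hp.le)).tendsto
    rw [Real.zero_rpow hp.ne'] at hc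
    exact hc.comp h3
  refine hasFDerivAt_of_tendstoUniformly (l := atTop) (f := fun n => remPotentialT K g f (εs n))
    (f' := fun n => remGradT K g f (εs n)) ?_ (fun n y => hasFDerivAt_remPotentialT hK hg hγ hf hsupp (hεpos n) y)
    (fun y => ?_) x
  · -- uniform convergence of the derivatives
    rw [Metric.tendstoUniformly_iff]
    intro δ hδ
    have hb : Tendsto (fun n => A * (4 + 2 * B) * H * M * (4 * π * (3 * εs n) ^ (γ : ℝ) / (γ : ℝ)))
        atTop (𝓝 0) := by
      have := (((hrate _ hγ').const_mul (4 * π)).div_const (γ : ℝ)).const_mul (A * (4 + 2 * B) * H * M)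
      simpa using this
    filter_upwards [hb.eventually (gt_mem_nhds hδ)] with n hn y
    rw [dist_comm, dist_eq_norm]
    exact (norm_remGradT_sub_le hK hB0 hB hg hγ hγ1 hf hR hsupp hM (hεpos n) y).trans_lt hn
  · -- pointwise convergence of the potentials
    rw [tendsto_iff_norm_sub_tendsto_zero]
    have hb : Tendsto (fun n => 2 * A * H * M * (4 * π * (3 * εs n) ^ ((γ : ℝ) + 1) / ((γ : ℝ) + 1)))
        atTop (𝓝 0) := by
      have := (((hrate _ (by positivity : (0:ℝ) < γ + 1)).const_mul (4 * π)).div_const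
        ((γ : ℝ) + 1)).const_mul (2 * A * H * M)
      simpa using this
    refine squeeze_zero (fun n => norm_nonneg _)
      (fun n => norm_remPotentialT_sub_le hK hg hγ hγ1 hf hR hsupp hM (hεpos n) y) hb

/-- **The remainder is `C¹`-differentiable** everywhere. [folklore] -/
theorem differentiable_remPotential (hK : IsC3SingularKernel K A) (hg : HolderGrad γ g H) (hγ : 0 < γ)
    (hγ1 : (γ : ℝ) < 1) (hf : Continuous f) (hR : 0 < R) (hsupp : tsupport f ⊆ closedBall c R)
    (hM : ∀ y, ‖f y‖ ≤ M) : Differentiable ℝ (remPotential K g f) := fun x =>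
  (hasFDerivAt_remPotential hK hg hγ hγ1 hf hR hsupp hM x).differentiableAt

/-- The derivative of the remainder is `remGrad`. [folklore] -/
theorem fderiv_remPotential (hK : IsC3SingularKernel K A) (hg : HolderGrad γ g H) (hγ : 0 < γ)
    (hγ1 : (γ : ℝ) < 1) (hf : Continuous f) (hR : 0 < R) (hsupp : tsupport f ⊆ closedBall c R)
    (hM : ∀ y, ‖f y‖ ≤ M) : fderiv ℝ (remPotential K g f) = remGrad K g f :=
  funext fun x => (hasFDerivAt_remPotential hK hg hγ hγ1 hf hR hsupp hM x).fderiv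

end Integrable


/-! ### The Hölder estimate of `remGrad`: the far integral carrying `∇g(x) − ∇g(x̄)` -/

section Holder

variable {K : ℝ³ → V →L[ℝ] W} {A : ℝ} {γ : ℝ≥0} {g : ℝ³ → ℝ³} {H : ℝ} {f : ℝ³ → V}
  {c : ℝ³} {R M : ℝ}

/-- **The far-field constant** of the one non-absolutely-integrable term: a bound for
`‖∫ (1 − ψ(y)) ∇K(x̄ − y)[·] f(y) dy‖` uniform in `x̄` and in the cutoff scale `δ`. [folklore] -/
def farFieldConst (A B : ℝ) (C : ℝ≥0) (M R γ : ℝ) : ℝ :=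
  A * C * (4 * π * (2 * (5 * R)) ^ γ / γ) + 256 * π / 3 * A * M + 256 * π / 3 * A * B * M +
    4 / 3 * π * A * M

/-- `farFieldConst ≥ 0`. [folklore] -/
theorem farFieldConst_nonneg {A B : ℝ} {C : ℝ≥0} {M R γ : ℝ} (hA : 0 ≤ A) (hB : 0 ≤ B) (hM : 0 ≤ M)
    (hR : 0 ≤ R) (hγ : 0 < γ) : 0 ≤ farFieldConst A B C M R γ := by
  unfold farFieldConst
  positivity

/-- **The truncated far integral of `∇K` against `f` is bounded uniformly** in the centre and the
scale: `‖∫ (1 − ψ_δ(y)) (∇K(x̄ − y) ·)(f y) dy‖ ≤ farFieldConst`. If `x̄` is within `2R` of the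
support centre, split `f y = (f y − χ(y) f x̄) + χ(y) f x̄` with the support cutoff `χ` at scale
`5R`: the first part converges absolutely (`norm_gradIntegrand_le`), the second is the tree's
cancellation lemma `norm_integral_far_ibp_le`; otherwise `f x̄ = 0` and `|x̄ − y| ≥ R` on the
support. This is (4.35) of Majda–Bertozzi (uniform bound for truncated singular integrals of a
compactly supported Hölder density) in the form needed here. [cite: MajdaBertozziCUP2002, §4.1.3 Lemma 4.6 (4.35) (p. 128) and §4.5 (p. 144)] -/
theorem norm_integral_far_fderiv_le [CompleteSpace W] (hK : IsC2SingularKernel K A) {B : ℝ}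
    (hB0 : 0 ≤ B) (hB : ∀ ε : ℝ, 0 < ε → ∀ z : ℝ³, ‖fderiv ℝ (radialCutoff ε (2 * ε)) z‖ ≤ B * ε⁻¹)
    {C : ℝ≥0} (hγ : 0 < γ) (hf : HolderWith C γ f) (hR : 0 < R)
    (hsupp : tsupport f ⊆ closedBall c R) (hM : ∀ y, ‖f y‖ ≤ M) {x x' : ℝ³} {δ : ℝ} (hδ0 : 0 < δ)
    (hδ : ‖x - x'‖ ≤ δ) :
    ‖∫ y, (1 - suppCutoff (mid x x') δ y) • (fderiv ℝ K (x' - y)).flip (f y)‖ ≤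
      farFieldConst A B C M R γ := by
  have hA := hK.nonneg
  have hM0 : 0 ≤ M := (norm_nonneg _).trans (hM x)
  have hγ' : (0 : ℝ) < γ := by exact_mod_cast hγ
  have hfc : HasCompactSupport f := hasCompactSupport_of_tsupport_subset hsupp
  have hfcont : Continuous f := hf.continuous hγ
  have hx'ξ : ‖x' - mid x x'‖ ≤ δ / 2 := by rw [norm_sub_mid']; linarith
  have t1 : 0 ≤ A * C * (4 * π * (2 * (5 * R)) ^ (γ : ℝ) / γ) := by positivity
  have t2 : 0 ≤ 256 * π / 3 * A * M := by positivity
  have t3 : 0 ≤ 256 * π / 3 * A * B * M := by positivity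
  have t4 : 0 ≤ 4 / 3 * π * A * M := by positivity
  by_cases hnear : ‖x' - c‖ < 2 * R
  · -- split with the support cutoff at scale `ρ = 5R`
    set ρ : ℝ := 5 * R with hρ
    have hρ0 : 0 < ρ := by positivity
    have hsupp' : tsupport f ⊆ closedBall c ρ := hsupp.trans (closedBall_subset_closedBall (by linarith))
    have hx' : ‖x' - c‖ < ρ / 2 := by rw [hρ]; linarith
    set χ := suppCutoff c ρ with hχ
    have hχc : Continuous χ := (contDiff_suppCutoff c ρ (n := 0)).continuous
    have hχs : HasCompactSupport χ := hasCompactSupport_suppCutoff c hρ0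
    have hg1 : Continuous fun y => f y - χ y • f x' := hfcont.sub (hχc.smul continuous_const)
    have hg1c : HasCompactSupport fun y => f y - χ y • f x' := hfc.sub hχs.smul_right
    have hg2 : Continuous fun y => χ y • f x' := hχc.smul continuous_const
    have hg2c : HasCompactSupport fun y => χ y • f x' := hχs.smul_right
    have i1 := integrable_far_piece hK.toIsC1SingularKernel hδ0 hx'ξ hg1 hg1c
    have i2 := integrable_far_piece hK.toIsC1SingularKernel hδ0 hx'ξ hg2 hg2c
    have hsplit : (fun y => (1 - suppCutoff (mid x x') δ y) • (fderiv ℝ K (x' - y)).flip (f y)) =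
        fun y => (1 - suppCutoff (mid x x') δ y) • (fderiv ℝ K (x' - y)).flip (f y - χ y • f x') +
          (1 - suppCutoff (mid x x') δ y) • (fderiv ℝ K (x' - y)).flip (χ y • f x') := by
      funext y
      rw [← smul_add, ← map_add, sub_add_cancel]
    rw [hsplit, integral_add i1 i2]
    refine (norm_add_le _ _).trans ?_
    have e1 : ‖∫ y, (1 - suppCutoff (mid x x') δ y) • (fderiv ℝ K (x' - y)).flip (f y - χ y • f x')‖ ≤
        A * C * (4 * π * (2 * ρ) ^ (γ : ℝ) / γ) + 256 * π / 3 * A * M := by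
      have hlin : ∫⁻ y, ENNReal.ofReal (A * C * holderMajorant γ (2 * ρ) (x' - y) +
          8 * A * M * (ρ ^ 3)⁻¹ * (closedBall c (2 * ρ)).indicator (fun _ => (1 : ℝ)) y) =
          ENNReal.ofReal (A * C * (4 * π * (2 * ρ) ^ (γ : ℝ) / γ) + 256 * π / 3 * A * M) := by
        have h1 : ∀ y, 0 ≤ A * C * holderMajorant γ (2 * ρ) (x' - y) := fun y =>
          mul_nonneg (by positivity) (holderMajorant_nonneg _ _ _)
        have h2 : ∀ y, 0 ≤ 8 * A * M * (ρ ^ 3)⁻¹ * (closedBall c (2 * ρ)).indicator (fun _ => (1 : ℝ)) y :=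
          fun y => mul_nonneg (by positivity) (indicator_nonneg (fun _ _ => zero_le_one) _)
        have hmeas : Measurable fun y => ENNReal.ofReal (A * C * holderMajorant γ (2 * ρ) (x' - y)) :=
          (((measurable_holderMajorant (γ : ℝ) (2 * ρ)).comp (measurable_const.sub measurable_id)).const_mul
            _).ennreal_ofReal
        simp_rw [ENNReal.ofReal_add (h1 _) (h2 _)]
        rw [lintegral_add_left hmeas]
        simp_rw [ENNReal.ofReal_mul (by positivity : (0 : ℝ) ≤ A * C),
          ENNReal.ofReal_mul (by positivity : (0 : ℝ) ≤ 8 * A * M * (ρ ^ 3)⁻¹)]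
        rw [lintegral_const_mul' _ _ ENNReal.ofReal_ne_top, lintegral_const_mul' _ _ ENNReal.ofReal_ne_top,
          lintegral_holderMajorant_sub_left hγ' (by positivity) x',
          lintegral_indicator_closedBall (by positivity : (0 : ℝ) ≤ 2 * ρ),
          ← ENNReal.ofReal_mul (by positivity), ← ENNReal.ofReal_mul (by positivity),
          ← ENNReal.ofReal_add (by positivity) (by positivity)]
        congr 1
        field_simp
        ring
      have hmaj : ∀ y, ‖(1 - suppCutoff (mid x x') δ y) • (fderiv ℝ K (x' - y)).flip (f y - χ y • f x')‖ ≤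
          1 * (A * C * holderMajorant γ (2 * ρ) (x' - y) +
            8 * A * M * (ρ ^ 3)⁻¹ * (closedBall c (2 * ρ)).indicator (fun _ => (1 : ℝ)) y) := by
        intro y
        rw [one_mul, norm_smul, Real.norm_eq_abs]
        calc |1 - suppCutoff (mid x x') δ y| * ‖(fderiv ℝ K (x' - y)).flip (f y - χ y • f x')‖
            ≤ 1 * ‖(fderiv ℝ K (x' - y)).flip (f y - χ y • f x')‖ := by
              gcongr; exact abs_one_sub_suppCutoff_le _ _ _
          _ ≤ _ := by
              rw [one_mul]
              exact norm_gradIntegrand_le hK.toIsC1SingularKernel hf hρ0 hsupp' hM hx' y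
      have h := norm_integral_le_of_le_majorant (c := 1) zero_le_one
        (I := A * C * (4 * π * (2 * ρ) ^ (γ : ℝ) / γ) + 256 * π / 3 * A * M) (by positivity)
        (le_of_eq hlin) hmaj
      rwa [one_mul] at h
    have e2 : ‖∫ y, (1 - suppCutoff (mid x x') δ y) • (fderiv ℝ K (x' - y)).flip (χ y • f x')‖ ≤
        256 * π / 3 * A * B * M :=
      (norm_integral_far_ibp_le hK.toIsC1SingularKernel hB0 hB hρ0 hx' hδ0 hδ (f x')).trans
        (by gcongr; exact hM x')
    have hρR : (2 * ρ) ^ (γ : ℝ) = (2 * (5 * R)) ^ (γ : ℝ) := by rw [hρ]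
    unfold farFieldConst
    rw [← hρR]
    linarith
  · -- `x̄` is far from the support: `f x̄ = 0`, `|x̄ − y| ≥ R` on the support
    have hfar : 2 * R ≤ ‖x' - c‖ := not_lt.1 hnear
    have hpt : ∀ y, ‖(1 - suppCutoff (mid x x') δ y) • (fderiv ℝ K (x' - y)).flip (f y)‖ ≤
        A * (R ^ 3)⁻¹ * M * (closedBall c R).indicator (fun _ => (1 : ℝ)) y := by
      intro y
      by_cases hfy : f y = 0
      · rw [hfy, map_zero, smul_zero, norm_zero]
        exact mul_nonneg (by positivity) (indicator_nonneg (fun _ _ => zero_le_one) _)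
      · have hy : y ∈ closedBall c R := hsupp (subset_tsupport f (mem_support.2 hfy))
        have hyR : ‖y - c‖ ≤ R := by rwa [mem_closedBall, dist_eq_norm] at hy
        have hxy : R ≤ ‖x' - y‖ := by
          have : ‖x' - c‖ ≤ ‖x' - y‖ + ‖y - c‖ := norm_sub_le_norm_sub_add_norm_sub _ _ _
          linarith
        have hxy0 : x' - y ≠ 0 := by
          intro h; rw [h, norm_zero] at hxy; linarith
        rw [indicator_of_mem hy, mul_one, norm_smul, Real.norm_eq_abs]
        have hD : ‖fderiv ℝ K (x' - y)‖ ≤ A * (R ^ 3)⁻¹ := by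
          refine (hK.norm_fderiv_le _ hxy0).trans ?_
          gcongr
        calc |1 - suppCutoff (mid x x') δ y| * ‖(fderiv ℝ K (x' - y)).flip (f y)‖
            ≤ 1 * (‖(fderiv ℝ K (x' - y)).flip‖ * ‖f y‖) := by
              gcongr
              · exact abs_one_sub_suppCutoff_le _ _ _
              · exact ContinuousLinearMap.le_opNorm _ _
          _ = ‖fderiv ℝ K (x' - y)‖ * ‖f y‖ := by rw [one_mul, ContinuousLinearMap.opNorm_flip]
          _ ≤ A * (R ^ 3)⁻¹ * M := by gcongr; exact hM y
    have h := norm_integral_le_of_le_majorant (by positivity : (0 : ℝ) ≤ A * (R ^ 3)⁻¹ * M)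
      (by positivity : (0 : ℝ) ≤ 4 / 3 * π * R ^ 3) (le_of_eq (lintegral_indicator_closedBall hR.le)) hpt
    have heq : A * (R ^ 3)⁻¹ * M * (4 / 3 * π * R ^ 3) = 4 / 3 * π * A * M := by
      field_simp
    rw [heq] at h
    unfold farFieldConst
    linarith

/-! ### The Hölder estimate of `remGrad`: the far-field difference -/

/-- `t^{1+γ} (t⁵)⁻¹ = t^{γ−4}` for `t > 0`. [folklore] -/
theorem rpow_one_add_mul_inv_pow_five {t : ℝ} (ht : 0 < t) (γ : ℝ) :
    t ^ (1 + γ) * (t ^ 5)⁻¹ = t ^ (γ - 4) := by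
  rw [show γ - 4 = (1 + γ) - ((5 : ℕ) : ℝ) by push_cast; ring, Real.rpow_sub ht, Real.rpow_natCast,
    div_eq_mul_inv]

/-- `(5/4)^p ≤ 25/16` for `0 ≤ p ≤ 2`. [folklore] -/
theorem five_fourths_rpow_le {p : ℝ} (hp : p ≤ 2) : (5 / 4 : ℝ) ^ p ≤ 25 / 16 := by
  calc (5 / 4 : ℝ) ^ p ≤ (5 / 4 : ℝ) ^ (2 : ℝ) :=
        Real.rpow_le_rpow_of_exponent_le (by norm_num) hp
    _ = 25 / 16 := by rw [Real.rpow_two]; norm_num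

/-- `(5/4)^p ≤ 5/4` for `p ≤ 1`. [folklore] -/
theorem five_fourths_rpow_le' {p : ℝ} (hp : p ≤ 1) : (5 / 4 : ℝ) ^ p ≤ 5 / 4 := by
  calc (5 / 4 : ℝ) ^ p ≤ (5 / 4 : ℝ) ^ (1 : ℝ) :=
        Real.rpow_le_rpow_of_exponent_le (by norm_num) hp
    _ = 5 / 4 := Real.rpow_one _

/-- **The algebraic identity behind the far-field difference**: with `D, D̄` the second
derivatives, `P, P̄` the first, `ρ, ρ̄` the Taylor remainders at `x, x̄` and `Lₓ = ∇g(x) − ∇g(y)`,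
`L̄ = ∇g(x̄) − ∇g(y)`, `Lₓ − L̄ = ∇g(x) − ∇g(x̄)`:
`[(Dρ)v + (Pv)Lₓ] − [(D̄ρ̄)v + (P̄v)L̄] − (P̄v)(Lₓ − L̄) = ((D − D̄)ρ)v + (D̄(ρ − ρ̄))v + ((P − P̄)v)Lₓ`. [folklore] -/
theorem remGradIntegrand_sub_sub_eq (D D' : ℝ³ →L[ℝ] ℝ³ →L[ℝ] V →L[ℝ] W) (P P' : ℝ³ →L[ℝ] V →L[ℝ] W)
    (ρ ρ' : ℝ³) (v : V) (Lx L' : ℝ³ →L[ℝ] ℝ³) :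
    ((D.flip ρ).flip v + (P.flip v).comp Lx) - ((D'.flip ρ').flip v + (P'.flip v).comp L') -
        (P'.flip v).comp (Lx - L') =
      ((D - D').flip ρ).flip v + (D'.flip (ρ - ρ')).flip v + ((P - P').flip v).comp Lx := by
  ext e
  simp only [sub_apply, add_apply, ContinuousLinearMap.flip_apply, ContinuousLinearMap.comp_apply, map_sub]
  abel
set_option maxHeartbeats 400000 in -- buildfix (bf3-g26): 160k/180k FAIL, 200k PASS at accept time; line-neutral budget line
/-- **The far-field difference bound**: for `δ = ‖x − x̄‖ > 0` and `‖y − ξ‖ ≥ 2δ`,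
`‖remGradIntegrand x y − remGradIntegrand x̄ y − (∇K(x̄ − y)[∇g(x) − ∇g(x̄)] ·) f(y)‖ ≤
75 A H M δ ‖ξ − y‖^{γ−4}` (mean value for `∇²K` with the third-derivative bound, the variation of
the Taylor remainder, and mean value for `∇K`; all distances comparable to `‖ξ − y‖`). [folklore] -/
theorem norm_remGradIntegrand_far_le (hK : IsC3SingularKernel K A) (hg : HolderGrad γ g H)
    (hγ1 : γ ≤ 1) (hM : ∀ y, ‖f y‖ ≤ M) {x x' y : ℝ³} (hxx' : x ≠ x')
    (hy : 2 * ‖x - x'‖ ≤ ‖y - mid x x'‖) :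
    ‖remGradIntegrand K g f x y - remGradIntegrand K g f x' y -
        ((fderiv ℝ K (x' - y)).flip (f y)).comp (fderiv ℝ g x - fderiv ℝ g x')‖ ≤
      75 * A * H * M * ‖x - x'‖ * ‖mid x x' - y‖ ^ ((γ : ℝ) - 4) := by
  have hA := hK.nonneg
  have hH := hg.nonneg
  have hM0 : 0 ≤ M := (norm_nonneg _).trans (hM y)
  have hγ1' : (γ : ℝ) ≤ 1 := by exact_mod_cast hγ1
  set δ : ℝ := ‖x - x'‖ with hδ
  have hδ0 : 0 < δ := norm_pos_iff.2 (sub_ne_zero.2 hxx')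
  set t : ℝ := ‖mid x x' - y‖ with ht
  have hyt : ‖y - mid x x'‖ = t := norm_sub_rev _ _
  have ht2 : 2 * δ ≤ t := by rwa [hyt] at hy
  have htpos : 0 < t := by linarith
  -- geometry: distances to `x`, `x̄` are comparable to `t`
  have hxξ : ‖x - mid x x'‖ = δ / 2 := norm_sub_mid x x'
  have hx'ξ : ‖x' - mid x x'‖ = δ / 2 := norm_sub_mid' x x'
  have hxy : ‖x - y‖ ≤ 5 / 4 * t := by
    have : ‖x - y‖ ≤ ‖x - mid x x'‖ + ‖mid x x' - y‖ := norm_sub_le_norm_sub_add_norm_sub _ _ _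
    linarith
  have hx'y : ‖x' - y‖ ≤ 5 / 4 * t := by
    have : ‖x' - y‖ ≤ ‖x' - mid x x'‖ + ‖mid x x' - y‖ := norm_sub_le_norm_sub_add_norm_sub _ _ _
    linarith
  have hx'y' : 3 / 4 * t ≤ ‖x' - y‖ := by
    have : ‖mid x x' - y‖ ≤ ‖mid x x' - x'‖ + ‖x' - y‖ := norm_sub_le_norm_sub_add_norm_sub _ _ _
    rw [norm_sub_rev (mid x x') x'] at this
    linarith
  have hxy0 : x - y ≠ 0 := by
    intro h
    have hyx : y = x := (sub_eq_zero.1 h).symm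
    rw [hyx, hxξ] at hy
    linarith
  have hx'y0 : x' - y ≠ 0 := by
    intro h; rw [h, norm_zero] at hx'y'; linarith
  -- the three pieces
  set D := fderiv ℝ (fderiv ℝ K) (x - y) with hD
  set D' := fderiv ℝ (fderiv ℝ K) (x' - y) with hD'
  set P := fderiv ℝ K (x - y) with hP
  set P' := fderiv ℝ K (x' - y) with hP'
  set ρ := taylorRem g x y with hρ
  set ρ' := taylorRem g x' y with hρ'
  set v := f y with hv
  have hid := remGradIntegrand_sub_sub_eq D D' P P' ρ ρ' v (fderiv ℝ g x - fderiv ℝ g y)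
    (fderiv ℝ g x' - fderiv ℝ g y)
  have hL : fderiv ℝ g x - fderiv ℝ g y - (fderiv ℝ g x' - fderiv ℝ g y) = fderiv ℝ g x - fderiv ℝ g x' := by
    abel
  rw [hL] at hid
  change ‖((D.flip ρ).flip v + (P.flip v).comp (fderiv ℝ g x - fderiv ℝ g y)) -
      ((D'.flip ρ').flip v + (P'.flip v).comp (fderiv ℝ g x' - fderiv ℝ g y)) -
      (P'.flip v).comp (fderiv ℝ g x - fderiv ℝ g x')‖ ≤ _
  rw [hid]
  -- powers of `t`
  have hpow1 : (5 / 4 * t) ^ (1 + (γ : ℝ)) ≤ 25 / 16 * t ^ (1 + (γ : ℝ)) := by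
    rw [Real.mul_rpow (by norm_num) htpos.le]
    gcongr
    exact five_fourths_rpow_le (by linarith)
  have hpow2 : (5 / 4 * t) ^ (γ : ℝ) ≤ 5 / 4 * t ^ (γ : ℝ) := by
    rw [Real.mul_rpow (by norm_num) htpos.le]
    gcongr
    exact five_fourths_rpow_le' hγ1'
  -- (i) mean value for `∇²K`
  have e1 : ‖((D - D').flip ρ).flip v‖ ≤ 50 * A * H * M * δ * t ^ ((γ : ℝ) - 4) := by
    refine (norm_flip_flip_le _ _ _).trans ?_
    have hDD : ‖D - D'‖ ≤ A * ((t / 2) ^ 5)⁻¹ * δ := hK.norm_fderiv₂_sub_le hδ0 le_rfl (by rw [hyt]; linarith)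
    have hρb : ‖ρ‖ ≤ H * (25 / 16 * t ^ (1 + (γ : ℝ))) :=
      (hg.norm_taylorRem_le x y).trans (by gcongr; exact (Real.rpow_le_rpow (norm_nonneg _) hxy (by positivity)).trans hpow1)
    calc ‖D - D'‖ * ‖ρ‖ * ‖v‖ ≤ (A * ((t / 2) ^ 5)⁻¹ * δ) * (H * (25 / 16 * t ^ (1 + (γ : ℝ)))) * M := by
          gcongr; exact hM y
      _ = 50 * A * H * M * δ * (t ^ (1 + (γ : ℝ)) * (t ^ 5)⁻¹) := by field_simp; ring
      _ = 50 * A * H * M * δ * t ^ ((γ : ℝ) - 4) := by rw [rpow_one_add_mul_inv_pow_five htpos]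
  -- (ii) variation of the Taylor remainder
  have e2 : ‖(D'.flip (ρ - ρ')).flip v‖ ≤ 5 * A * H * M * δ * t ^ ((γ : ℝ) - 4) := by
    refine (norm_flip_flip_le _ _ _).trans ?_
    have hD'b : ‖D'‖ ≤ A * ((3 / 4 * t) ^ 4)⁻¹ := by
      refine (hK.norm_fderiv₂_le _ hx'y0).trans ?_
      gcongr
    have hρρ : ‖ρ - ρ'‖ ≤ H * δ * (5 / 4 * t ^ (γ : ℝ)) := by
      refine (hg.norm_taylorRem_sub_le x x' y).trans ?_
      have : (‖mid x x' - y‖ + ‖x - x'‖ / 2) ^ (γ : ℝ) ≤ (5 / 4 * t) ^ (γ : ℝ) :=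
        Real.rpow_le_rpow (by positivity) (by rw [← ht, ← hδ]; linarith) (by positivity)
      calc H * ‖x - x'‖ * (‖mid x x' - y‖ + ‖x - x'‖ / 2) ^ (γ : ℝ) ≤ H * δ * (5 / 4 * t) ^ (γ : ℝ) := by
            rw [← hδ]; gcongr
        _ ≤ H * δ * (5 / 4 * t ^ (γ : ℝ)) := by gcongr
    calc ‖D'‖ * ‖ρ - ρ'‖ * ‖v‖ ≤ (A * ((3 / 4 * t) ^ 4)⁻¹) * (H * δ * (5 / 4 * t ^ (γ : ℝ))) * M := by
          gcongr; exact hM y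
      _ = (256 / 81 * (5 / 4)) * A * H * M * δ * (t ^ (γ : ℝ) * (t ^ 4)⁻¹) := by field_simp; ring
      _ ≤ 5 * A * H * M * δ * (t ^ (γ : ℝ) * (t ^ 4)⁻¹) := by gcongr; norm_num
      _ = 5 * A * H * M * δ * t ^ ((γ : ℝ) - 4) := by rw [rpow_mul_inv_pow_four htpos]
  -- (iii) mean value for `∇K`
  have e3 : ‖((P - P').flip v).comp (fderiv ℝ g x - fderiv ℝ g y)‖ ≤ 20 * A * H * M * δ * t ^ ((γ : ℝ) - 4) := by
    refine (norm_flip_comp_le _ _ _).trans ?_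
    have hPP : ‖P - P'‖ ≤ A * ((t / 2) ^ 4)⁻¹ * δ :=
      norm_fderiv_kernel_sub_le hK.isC2 hδ0 le_rfl (by rw [hyt]; linarith)
    have hgg : ‖fderiv ℝ g x - fderiv ℝ g y‖ ≤ H * (5 / 4 * t ^ (γ : ℝ)) :=
      (hg.norm_sub_le x y).trans (by gcongr; exact (Real.rpow_le_rpow (norm_nonneg _) hxy (by positivity)).trans hpow2)
    calc ‖P - P'‖ * ‖v‖ * ‖fderiv ℝ g x - fderiv ℝ g y‖
        ≤ (A * ((t / 2) ^ 4)⁻¹ * δ) * M * (H * (5 / 4 * t ^ (γ : ℝ))) := by gcongr; exact hM y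
      _ = 20 * A * H * M * δ * (t ^ (γ : ℝ) * (t ^ 4)⁻¹) := by field_simp; ring
      _ = 20 * A * H * M * δ * t ^ ((γ : ℝ) - 4) := by rw [rpow_mul_inv_pow_four htpos]
  calc ‖((D - D').flip ρ).flip v + (D'.flip (ρ - ρ')).flip v + ((P - P').flip v).comp (fderiv ℝ g x - fderiv ℝ g y)‖
      ≤ ‖((D - D').flip ρ).flip v‖ + ‖(D'.flip (ρ - ρ')).flip v‖ +
          ‖((P - P').flip v).comp (fderiv ℝ g x - fderiv ℝ g y)‖ := norm_add₃_le
    _ ≤ 50 * A * H * M * δ * t ^ ((γ : ℝ) - 4) + 5 * A * H * M * δ * t ^ ((γ : ℝ) - 4) +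
          20 * A * H * M * δ * t ^ ((γ : ℝ) - 4) := add_le_add (add_le_add e1 e2) e3
    _ = 75 * A * H * M * ‖x - x'‖ * ‖mid x x' - y‖ ^ ((γ : ℝ) - 4) := by rw [← hδ, ← ht]; ring

/-! ### The Hölder estimate of `remGrad`: assembly -/

/-- **The Hölder constant of `remGrad`, per unit `H`.** [folklore] -/
def remHolderConst (A B : ℝ) (C : ℝ≥0) (M R γ : ℝ) : ℝ :=
  A * M * (48 * π / γ + 256 * π / 3 + 300 * π / (1 - γ)) + farFieldConst A B C M R γ

/-- `remHolderConst ≥ 0`. [folklore] -/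
theorem remHolderConst_nonneg {A B : ℝ} {C : ℝ≥0} {M R γ : ℝ} (hA : 0 ≤ A) (hB : 0 ≤ B) (hM : 0 ≤ M)
    (hR : 0 ≤ R) (hγ : 0 < γ) (hγ1 : γ < 1) : 0 ≤ remHolderConst A B C M R γ := by
  unfold remHolderConst
  have := farFieldConst_nonneg (C := C) hA hB hM hR hγ
  have h1 : 0 < 1 - γ := by linarith
  positivity

/-- The real arithmetic of the near/far majorant: its integral is `≤ κ(γ) δ^γ`. [folklore] -/
theorem majorant_integral_le {γ δ : ℝ} (hγ : 0 < γ) (hγ1 : γ < 1) (hδ : 0 < δ) :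
    2 * (4 * π * (3 * δ) ^ γ / γ) + 2 * (4 * π * (3 * δ) ^ γ / γ) +
        8 * (δ ^ 3)⁻¹ * δ ^ γ * (4 / 3 * π * (2 * δ) ^ 3) +
        75 * δ * (4 * π * (2 * δ) ^ (γ - 1) / (1 - γ)) ≤
      (48 * π / γ + 256 * π / 3 + 300 * π / (1 - γ)) * δ ^ γ := by
  have h1γ : 0 < 1 - γ := by linarith
  -- `(3δ)^γ ≤ 3 δ^γ`
  have h3 : (3 * δ) ^ γ ≤ 3 * δ ^ γ := by
    rw [Real.mul_rpow (by norm_num) hδ.le]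
    gcongr
    calc (3 : ℝ) ^ γ ≤ (3 : ℝ) ^ (1 : ℝ) := Real.rpow_le_rpow_of_exponent_le (by norm_num) hγ1.le
      _ = 3 := Real.rpow_one _
  -- `δ (2δ)^{γ-1} ≤ δ^γ`
  have h2 : δ * (2 * δ) ^ (γ - 1) ≤ δ ^ γ := by
    rw [Real.mul_rpow (by norm_num) hδ.le, Real.rpow_sub_one hδ.ne']
    have h21 : (2 : ℝ) ^ (γ - 1) ≤ 1 := Real.rpow_le_one_of_one_le_of_nonpos (by norm_num) (by linarith)
    have hδγ : 0 < δ ^ γ := Real.rpow_pos_of_pos hδ γ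
    calc δ * ((2 : ℝ) ^ (γ - 1) * (δ ^ γ / δ)) = (2 : ℝ) ^ (γ - 1) * δ ^ γ := by field_simp
      _ ≤ 1 * δ ^ γ := by gcongr
      _ = δ ^ γ := one_mul _
  -- the exact middle term
  have hmid : 8 * (δ ^ 3)⁻¹ * δ ^ γ * (4 / 3 * π * (2 * δ) ^ 3) = 256 * π / 3 * δ ^ γ := by
    field_simp
    ring
  have e1 : 2 * (4 * π * (3 * δ) ^ γ / γ) + 2 * (4 * π * (3 * δ) ^ γ / γ) ≤ 48 * π / γ * δ ^ γ := by
    have : 4 * π * (3 * δ) ^ γ / γ ≤ 4 * π * (3 * δ ^ γ) / γ := by gcongr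
    calc 2 * (4 * π * (3 * δ) ^ γ / γ) + 2 * (4 * π * (3 * δ) ^ γ / γ)
        ≤ 2 * (4 * π * (3 * δ ^ γ) / γ) + 2 * (4 * π * (3 * δ ^ γ) / γ) := by gcongr
      _ = 48 * π / γ * δ ^ γ := by field_simp; ring
  have e3 : 75 * δ * (4 * π * (2 * δ) ^ (γ - 1) / (1 - γ)) ≤ 300 * π / (1 - γ) * δ ^ γ := by
    calc 75 * δ * (4 * π * (2 * δ) ^ (γ - 1) / (1 - γ)) = 300 * π / (1 - γ) * (δ * (2 * δ) ^ (γ - 1)) := by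
          field_simp
          ring
      _ ≤ 300 * π / (1 - γ) * δ ^ γ := by gcongr
  rw [hmid]
  nlinarith [e1, e3, Real.rpow_pos_of_pos hδ γ]
set_option maxHeartbeats 400000 in -- buildfix (bf3-g26): 160k/180k FAIL, 200k PASS at accept time; line-neutral budget line
/-- **The Hölder estimate of the remainder's derivative** (the heart of the bound (4.41)/(4.93)
for `G₂(X)Y`): `‖remGrad x − remGrad x̄‖ ≤ H · remHolderConst · |x − x̄|^γ`. Split at the
midpoint `ξ` with `δ = |x − x̄|`: near `ξ` both derivative integrands are absolutely integrable
with majorant `|x − y|^{γ−3}`; far from `ξ` the difference, minus the single term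
`(∇K(x̄ − y)[∇g(x) − ∇g(x̄)] ·) f(y)`, is `O(δ |ξ − y|^{γ−4})` (`norm_remGradIntegrand_far_le`);
that term is cut off smoothly near `ξ`, integrates to `(∫ (1−ψ)∇K(x̄−y)f(y) dy) ∘ (∇g(x) − ∇g(x̄))`
and is bounded by `farFieldConst · H δ^γ` (`norm_integral_far_fderiv_le`). [cite: MajdaBertozziCUP2002, §4.5 Lemma 4.10 (4.93) (p. 145–147) with the proof of Lemma 4.6 (p. 144–145)] -/
theorem norm_remGrad_sub_le [CompleteSpace W] (hK : IsC3SingularKernel K A) {B : ℝ} (hB0 : 0 ≤ B)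
    (hB : ∀ ε : ℝ, 0 < ε → ∀ z : ℝ³, ‖fderiv ℝ (radialCutoff ε (2 * ε)) z‖ ≤ B * ε⁻¹)
    {C : ℝ≥0} (hγ : 0 < γ) (hγ1 : (γ : ℝ) < 1) (hg : HolderGrad γ g H) (hf : HolderWith C γ f)
    (hR : 0 < R) (hsupp : tsupport f ⊆ closedBall c R) (hM : ∀ y, ‖f y‖ ≤ M) (x x' : ℝ³) :
    ‖remGrad K g f x - remGrad K g f x'‖ ≤
      H * remHolderConst A B C M R γ * ‖x - x'‖ ^ (γ : ℝ) := by
  have hA := hK.nonneg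
  have hH := hg.nonneg
  have hM0 : 0 ≤ M := (norm_nonneg _).trans (hM x)
  have hγ' : (0 : ℝ) < γ := by exact_mod_cast hγ
  have hγ1' : γ ≤ 1 := by exact_mod_cast hγ1.le
  rcases eq_or_ne x x' with rfl | hxx'
  · simp only [sub_self, norm_zero, Real.zero_rpow hγ'.ne', mul_zero, le_refl]
  set δ : ℝ := ‖x - x'‖ with hδ
  have hδ0 : 0 < δ := norm_pos_iff.2 (sub_ne_zero.2 hxx')
  have hfc : HasCompactSupport f := hasCompactSupport_of_tsupport_subset hsupp
  have hfcont : Continuous f := hf.continuous hγ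
  have hx'ξ : ‖x' - mid x x'‖ ≤ δ / 2 := by rw [norm_sub_mid']
  -- the far piece and the single cancellation term
  set L : ℝ³ →L[ℝ] ℝ³ := fderiv ℝ g x - fderiv ℝ g x' with hL
  have hLn : ‖L‖ ≤ H * δ ^ (γ : ℝ) := hg.norm_sub_le x x'
  set φ : ℝ³ → ℝ³ →L[ℝ] W := fun y => (1 - suppCutoff (mid x x') δ y) • (fderiv ℝ K (x' - y)).flip (f y)
    with hφ
  have iφ : Integrable φ := integrable_far_piece hK.toIsC1SingularKernel hδ0 hx'ξ hfcont hfc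
  set T : ℝ³ → ℝ³ →L[ℝ] W := fun y => (φ y).comp L with hT
  have iT : Integrable T := ((ContinuousLinearMap.compL ℝ ℝ³ ℝ³ W).flip L).integrable_comp iφ
  have hTint : ∫ y, T y = (∫ y, φ y).comp L :=
    ((ContinuousLinearMap.compL ℝ ℝ³ ℝ³ W).flip L).integral_comp_comm iφ
  -- the integrands
  have iX := integrable_remGradIntegrand hK hg hγ hγ1 hfcont hR hsupp hM x
  have iX' := integrable_remGradIntegrand hK hg hγ hγ1 hfcont hR hsupp hM x'
  set D₁ : ℝ³ → ℝ³ →L[ℝ] W := fun y => remGradIntegrand K g f x y - remGradIntegrand K g f x' y - T y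
    with hD₁
  have iD₁ : Integrable D₁ := (iX.sub iX').sub iT
  have hdecomp : remGrad K g f x - remGrad K g f x' = (∫ y, D₁ y) + ∫ y, T y := by
    rw [remGrad, remGrad, ← integral_sub iX iX', ← integral_add iD₁ iT]
    congr 1
    funext y
    simp only [hD₁, sub_add_cancel]
  -- the majorant of `D₁`
  set m : ℝ³ → ℝ := fun y => 2 * holderMajorant γ (3 * δ) (x - y) + 2 * holderMajorant γ (3 * δ) (x' - y) +
      8 * (δ ^ 3)⁻¹ * δ ^ (γ : ℝ) * (closedBall (mid x x') (2 * δ)).indicator (fun _ => (1 : ℝ)) y +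
      75 * δ * extMajorant γ (2 * δ) (mid x x' - y) with hm
  have hm1 : ∀ y, 0 ≤ 2 * holderMajorant γ (3 * δ) (x - y) := fun y =>
    mul_nonneg zero_le_two (holderMajorant_nonneg _ _ _)
  have hm2 : ∀ y, 0 ≤ 2 * holderMajorant γ (3 * δ) (x' - y) := fun y =>
    mul_nonneg zero_le_two (holderMajorant_nonneg _ _ _)
  have hm3 : ∀ y, 0 ≤ 8 * (δ ^ 3)⁻¹ * δ ^ (γ : ℝ) *
      (closedBall (mid x x') (2 * δ)).indicator (fun _ => (1 : ℝ)) y := fun y =>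
    mul_nonneg (by positivity) (indicator_nonneg (fun _ _ => zero_le_one) _)
  have hm4 : ∀ y, 0 ≤ 75 * δ * extMajorant γ (2 * δ) (mid x x' - y) := fun y =>
    mul_nonneg (by positivity) (extMajorant_nonneg _ _ _)
  -- pointwise bound of `D₁`
  have hpt : ∀ y, ‖D₁ y‖ ≤ A * H * M * m y := by
    intro y
    by_cases hfar : 2 * δ ≤ ‖y - mid x x'‖
    · -- far: the cutoff vanishes and the far-field difference bound applies
      have hψ : suppCutoff (mid x x') δ y = 0 := suppCutoff_eq_zero hδ0 hfar
      have hTy : T y = ((fderiv ℝ K (x' - y)).flip (f y)).comp L := by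
        simp only [hT, hφ, hψ, sub_zero, one_smul]
      have h := norm_remGradIntegrand_far_le (f := f) hK hg hγ1' hM hxx' hfar
      rw [← hL, ← hTy] at h
      have hext : extMajorant γ (2 * δ) (mid x x' - y) = ‖mid x x' - y‖ ^ ((γ : ℝ) - 4) :=
        extMajorant_eq (by rwa [norm_sub_rev] at hfar)
      calc ‖D₁ y‖ ≤ 75 * A * H * M * ‖x - x'‖ * ‖mid x x' - y‖ ^ ((γ : ℝ) - 4) := h
        _ = A * H * M * (75 * δ * extMajorant γ (2 * δ) (mid x x' - y)) := by rw [hext, hδ]; ring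
        _ ≤ A * H * M * m y := by
            gcongr
            simp only [hm]
            linarith [hm1 y, hm2 y, hm3 y]
    · -- near: absolute bounds for the three pieces
      have hnear : ‖y - mid x x'‖ < 2 * δ := not_le.1 hfar
      have hyB : y ∈ closedBall (mid x x') (2 * δ) := by
        rw [mem_closedBall, dist_eq_norm]; exact hnear.le
      have hxy : ‖x - y‖ < 3 * δ := by
        have : ‖x - y‖ ≤ ‖x - mid x x'‖ + ‖mid x x' - y‖ := norm_sub_le_norm_sub_add_norm_sub _ _ _
        rw [norm_sub_mid, norm_sub_rev (mid x x') y] at this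
        linarith
      have hx'y : ‖x' - y‖ < 3 * δ := by
        have : ‖x' - y‖ ≤ ‖x' - mid x x'‖ + ‖mid x x' - y‖ := norm_sub_le_norm_sub_add_norm_sub _ _ _
        rw [norm_sub_rev (mid x x') y] at this
        linarith
      have hmx : holderMajorant γ (3 * δ) (x - y) = ‖x - y‖ ^ ((γ : ℝ) - 3) := by
        simp [holderMajorant, indicator, hxy]
      have hmx' : holderMajorant γ (3 * δ) (x' - y) = ‖x' - y‖ ^ ((γ : ℝ) - 3) := by
        simp [holderMajorant, indicator, hx'y]
      have e1 : ‖remGradIntegrand K g f x y‖ ≤ A * H * M * (2 * holderMajorant γ (3 * δ) (x - y)) := by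
        rw [hmx]
        calc ‖remGradIntegrand K g f x y‖ ≤ 2 * A * H * ‖f y‖ * ‖x - y‖ ^ ((γ : ℝ) - 3) :=
              norm_remGradIntegrand_le hK hg x y
          _ ≤ 2 * A * H * M * ‖x - y‖ ^ ((γ : ℝ) - 3) := by gcongr; exact hM y
          _ = A * H * M * (2 * ‖x - y‖ ^ ((γ : ℝ) - 3)) := by ring
      have e2 : ‖remGradIntegrand K g f x' y‖ ≤ A * H * M * (2 * holderMajorant γ (3 * δ) (x' - y)) := by
        rw [hmx']
        calc ‖remGradIntegrand K g f x' y‖ ≤ 2 * A * H * ‖f y‖ * ‖x' - y‖ ^ ((γ : ℝ) - 3) :=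
              norm_remGradIntegrand_le hK hg x' y
          _ ≤ 2 * A * H * M * ‖x' - y‖ ^ ((γ : ℝ) - 3) := by gcongr; exact hM y
          _ = A * H * M * (2 * ‖x' - y‖ ^ ((γ : ℝ) - 3)) := by ring
      have e3 : ‖T y‖ ≤ A * H * M * (8 * (δ ^ 3)⁻¹ * δ ^ (γ : ℝ) *
          (closedBall (mid x x') (2 * δ)).indicator (fun _ => (1 : ℝ)) y) := by
        rw [indicator_of_mem hyB, mul_one]
        by_cases hψ : 1 - suppCutoff (mid x x') δ y = 0
        · have : T y = 0 := by simp only [hT, hφ, hψ, zero_smul, ContinuousLinearMap.zero_comp]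
          rw [this, norm_zero]
          positivity
        · obtain ⟨-, hxy'⟩ := dist_of_one_sub_suppCutoff_ne_zero hδ0 hx'ξ hψ
          have hxy0 : x' - y ≠ 0 := by
            intro h0; rw [h0, norm_zero] at hxy'; linarith
          have hD : ‖fderiv ℝ K (x' - y)‖ ≤ 8 * A * (δ ^ 3)⁻¹ := by
            refine (hK.norm_fderiv_le _ hxy0).trans ?_
            have : (‖x' - y‖ ^ 3)⁻¹ ≤ ((δ / 2) ^ 3)⁻¹ :=
              inv_anti₀ (by positivity) (pow_le_pow_left₀ (by positivity) hxy'.le 3)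
            calc A * (‖x' - y‖ ^ 3)⁻¹ ≤ A * ((δ / 2) ^ 3)⁻¹ := by gcongr
              _ = 8 * A * (δ ^ 3)⁻¹ := by field_simp; ring
          calc ‖T y‖ = ‖((1 - suppCutoff (mid x x') δ y) • (fderiv ℝ K (x' - y)).flip (f y)).comp L‖ := rfl
            _ ≤ ‖(1 - suppCutoff (mid x x') δ y) • (fderiv ℝ K (x' - y)).flip (f y)‖ * ‖L‖ :=
                ContinuousLinearMap.opNorm_comp_le _ _
            _ = |1 - suppCutoff (mid x x') δ y| * ‖(fderiv ℝ K (x' - y)).flip (f y)‖ * ‖L‖ := by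
                rw [norm_smul, Real.norm_eq_abs]
            _ ≤ 1 * (‖(fderiv ℝ K (x' - y)).flip‖ * ‖f y‖) * (H * δ ^ (γ : ℝ)) := by
                gcongr
                · exact abs_one_sub_suppCutoff_le _ _ _
                · exact ContinuousLinearMap.le_opNorm _ _
            _ = ‖fderiv ℝ K (x' - y)‖ * ‖f y‖ * (H * δ ^ (γ : ℝ)) := by
                rw [one_mul, ContinuousLinearMap.opNorm_flip]
            _ ≤ 8 * A * (δ ^ 3)⁻¹ * M * (H * δ ^ (γ : ℝ)) := by gcongr; exact hM y
            _ = A * H * M * (8 * (δ ^ 3)⁻¹ * δ ^ (γ : ℝ)) := by ring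
      calc ‖D₁ y‖ ≤ ‖remGradIntegrand K g f x y‖ + ‖remGradIntegrand K g f x' y‖ + ‖T y‖ := by
            simp only [hD₁]; exact norm_sub_le_of_le (norm_sub_le _ _) le_rfl
        _ ≤ A * H * M * (2 * holderMajorant γ (3 * δ) (x - y)) +
            A * H * M * (2 * holderMajorant γ (3 * δ) (x' - y)) +
            A * H * M * (8 * (δ ^ 3)⁻¹ * δ ^ (γ : ℝ) *
              (closedBall (mid x x') (2 * δ)).indicator (fun _ => (1 : ℝ)) y) :=
            add_le_add (add_le_add e1 e2) e3
        _ ≤ A * H * M * m y := by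
            simp only [hm]
            nlinarith [hm4 y, mul_nonneg (mul_nonneg hA hH) hM0]
  -- the integral of the majorant
  set I : ℝ := 2 * (4 * π * (3 * δ) ^ (γ : ℝ) / γ) + 2 * (4 * π * (3 * δ) ^ (γ : ℝ) / γ) +
      8 * (δ ^ 3)⁻¹ * δ ^ (γ : ℝ) * (4 / 3 * π * (2 * δ) ^ 3) +
      75 * δ * (4 * π * (2 * δ) ^ ((γ : ℝ) - 1) / (1 - γ)) with hI
  have h1γ : (0 : ℝ) < 1 - γ := by linarith
  have hI0 : 0 ≤ I := by positivity
  have hlin : ∫⁻ y, ENNReal.ofReal (m y) = ENNReal.ofReal I := by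
    have meas1 : Measurable fun y => ENNReal.ofReal (2 * holderMajorant γ (3 * δ) (x - y)) :=
      (((measurable_holderMajorant (γ : ℝ) (3 * δ)).comp (measurable_const.sub measurable_id)).const_mul
        _).ennreal_ofReal
    have meas2 : Measurable fun y => ENNReal.ofReal (2 * holderMajorant γ (3 * δ) (x' - y)) :=
      (((measurable_holderMajorant (γ : ℝ) (3 * δ)).comp (measurable_const.sub measurable_id)).const_mul
        _).ennreal_ofReal
    have meas3 : Measurable fun y => ENNReal.ofReal (8 * (δ ^ 3)⁻¹ * δ ^ (γ : ℝ) *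
        (closedBall (mid x x') (2 * δ)).indicator (fun _ => (1 : ℝ)) y) :=
      ((measurable_const.indicator measurableSet_closedBall).const_mul _).ennreal_ofReal
    simp only [hm]
    simp_rw [ENNReal.ofReal_add (add_nonneg (add_nonneg (hm1 _) (hm2 _)) (hm3 _)) (hm4 _),
      ENNReal.ofReal_add (add_nonneg (hm1 _) (hm2 _)) (hm3 _), ENNReal.ofReal_add (hm1 _) (hm2 _)]
    have meas12 : Measurable fun y => ENNReal.ofReal (2 * holderMajorant γ (3 * δ) (x - y)) +
        ENNReal.ofReal (2 * holderMajorant γ (3 * δ) (x' - y)) := meas1.add meas2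
    have meas123 : Measurable fun y => ENNReal.ofReal (2 * holderMajorant γ (3 * δ) (x - y)) +
        ENNReal.ofReal (2 * holderMajorant γ (3 * δ) (x' - y)) +
        ENNReal.ofReal (8 * (δ ^ 3)⁻¹ * δ ^ (γ : ℝ) *
          (closedBall (mid x x') (2 * δ)).indicator (fun _ => (1 : ℝ)) y) := meas12.add meas3
    rw [lintegral_add_left meas123, lintegral_add_left meas12, lintegral_add_left meas1]
    simp_rw [ENNReal.ofReal_mul (zero_le_two : (0 : ℝ) ≤ 2),
      ENNReal.ofReal_mul (by positivity : (0 : ℝ) ≤ 8 * (δ ^ 3)⁻¹ * δ ^ (γ : ℝ)),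
      ENNReal.ofReal_mul (by positivity : (0 : ℝ) ≤ 75 * δ)]
    rw [lintegral_const_mul' _ _ ENNReal.ofReal_ne_top, lintegral_const_mul' _ _ ENNReal.ofReal_ne_top,
      lintegral_const_mul' _ _ ENNReal.ofReal_ne_top, lintegral_const_mul' _ _ ENNReal.ofReal_ne_top,
      lintegral_holderMajorant_sub_left hγ' (by positivity) x,
      lintegral_holderMajorant_sub_left hγ' (by positivity) x',
      lintegral_indicator_closedBall (by positivity : (0 : ℝ) ≤ 2 * δ),
      lintegral_extMajorant_sub_left hγ1 (by positivity) (mid x x'),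
      ← ENNReal.ofReal_mul zero_le_two,
      ← ENNReal.ofReal_mul (by positivity : (0 : ℝ) ≤ 8 * (δ ^ 3)⁻¹ * δ ^ (γ : ℝ)),
      ← ENNReal.ofReal_mul (by positivity : (0 : ℝ) ≤ 75 * δ),
      ← ENNReal.ofReal_add (by positivity) (by positivity),
      ← ENNReal.ofReal_add (by positivity) (by positivity),
      ← ENNReal.ofReal_add (by positivity) (by positivity)]
  have hD₁int : ‖∫ y, D₁ y‖ ≤ A * H * M * I :=
    norm_integral_le_of_le_majorant (by positivity) hI0 (le_of_eq hlin) hpt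
  have hIle : I ≤ (48 * π / γ + 256 * π / 3 + 300 * π / (1 - γ)) * δ ^ (γ : ℝ) :=
    majorant_integral_le hγ' hγ1 hδ0
  -- the cancellation term
  have hTn : ‖∫ y, T y‖ ≤ farFieldConst A B C M R γ * (H * δ ^ (γ : ℝ)) := by
    rw [hTint]
    refine (ContinuousLinearMap.opNorm_comp_le _ _).trans ?_
    have hfar := norm_integral_far_fderiv_le hK.isC2 hB0 hB hγ hf hR hsupp hM hδ0 le_rfl (x := x) (x' := x')
    have h0 : 0 ≤ farFieldConst A B C M R γ := farFieldConst_nonneg hA hB0 hM0 hR.le hγ'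
    exact mul_le_mul hfar hLn (norm_nonneg _) h0
  -- assembly
  rw [hdecomp]
  calc ‖(∫ y, D₁ y) + ∫ y, T y‖ ≤ ‖∫ y, D₁ y‖ + ‖∫ y, T y‖ := norm_add_le _ _
    _ ≤ A * H * M * I + farFieldConst A B C M R γ * (H * δ ^ (γ : ℝ)) := add_le_add hD₁int hTn
    _ ≤ A * H * M * ((48 * π / γ + 256 * π / 3 + 300 * π / (1 - γ)) * δ ^ (γ : ℝ)) +
          farFieldConst A B C M R γ * (H * δ ^ (γ : ℝ)) := by gcongr
    _ = H * remHolderConst A B C M R γ * δ ^ (γ : ℝ) := by rw [remHolderConst]; ring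

end Holder

end Literature.Analysis.FluidPDE
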